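import Summits.QuantumFields.QCD.Theses.NestedDissectionSea
import Literature.MathematicalPhysics.QuantumLattice.WilsonPositivityDomain
import Literature.MathematicalPhysics.QuantumFieldTheory.SpectralDefectDensity
import Summits.QuantumFields.QCD.Theorems.RobustYangMillsHandover.Negative.SchemeAsymptotics

/-!
# Disproof of `CoerciveSea` (crux stmt-QuantumFields-13901, route NestedDissectionSea) — findings

Standing crux-disprover work file (cdisprove seats refuter-cdisprove-stmt-QuantumFields-13901-0 (cycle 1)
and -g2-0 (cycle 2)). Prose lives in docstrings; everything not marked `sorry` is kernel-checked
(currently: 0 sorries).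

## Verdict so far: NO KILL (cycles 1–2). Why it resists — one paragraph

`CoerciveSea` is `∀ Nf ∈ {2,3} ∃ reg ∃ M₀ ∃ b₀ ∃ ℓ ∀ m > M₀ ∃ R (i) ∧ (ii) ∧ (iii)`: every
parameter a refuter could push to a degenerate regime (leaf size `b₀`, window `ℓ`, threshold `M₀`,
torus size `R`, the constants `C, α`, the whole regularisation `reg` including the free real data
`mcrit`) is EXISTENTIAL, i.e. prover-chosen; the refuter's levers are `m` (only delays `k`), `M`,
the volume `S` (all volumes `a_k(2S+1) ≥ R`, i.e. the thermodynamic limit at fixed `k`), the box and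
`t → 0`. Clauses (i),(ii) are upper bounds on probabilities of local semialgebraic events under an
honest probability measure (phase-quenched Wilson measure; no Bochner junk), so they can only fail
on PHYSICS (density of real Wilson–Dirac cell eigenvalues at the valence line), never structurally;
clause (iii) is the only lower bound and is what excludes the junk corners (Part A below).

## Contents

* Part A — LOAD-BEARING ANALYSIS OF THE PIN (iii), rigorous:
  `fermionDet_wilsonDirac_re_pos_of_four_lt_abs` (Seiler positivity extended to `m < -8`:
  `Re det D_W(U,m,1) > 0` whenever `|m+4| > 4`), hence for ANY witness `reg` of the crux the pin
  masses `mcrit k − a_k M / Z_m k` lie in the open interval `(-8, 0)` eventually, for every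
  `M > M₀` (`PinClause.mass_mem_Ioo`, `coerciveSea_pin_mass_mem_Ioo`; closure of Seiler
  positivity by continuity in the mass); junk-regularisation exclusions
  `not_coerciveSeaAt_of_frequently_le_neg_eight`, `not_coerciveSeaAt_of_frequently_ge`
  (the heavy corner `mcrit ≥ c > 0`, where (i) and (ii) are vacuous, is NOT a witness).
* Part B — cell-level positivity (the `μ ≥ 0` shadow of `KineticEdge`, and the substance of
  `DirichletDetReal`): `HasSingularSeparator U μ s τ → μ < |τ|`; the separator event sits inside
  the cell near-kernel event `σ_min(D_c) < |τ|` (so (i) follows from a CELL Wegner law); Dirichlet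
  cell determinants are real, and positive when `|μ+4| > 4`.
* LANDED on the negative lane `Summits/QuantumFields/QCD/Theorems/CoerciveSea/Negative/` (all four
  ACCEPTED; namespace `Summit.QuantumFields.QCD.Theorems.CoerciveSeaNegative`): `SeilerBothSides.lean`
  (p73265), `CellCoercivity.lean` (p74023), `CellDeterminants.lean` (p74898), `PinWindow.lean`
  (p75515, reviewed). Provers should import `…Negative.PinWindow` and cite THOSE declarations; this
  work file duplicates their content under its own namespace only so that it elaborates stand-alone
  (an import-based v4 is staged in the seat folder, `Disproof_v4.lean`, pending the farm build).
* Candidate proofs of the provable-now supports `DirichletDetReal` (stmt-11275),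
  `SignDefectForcesCrossing` (stmt-13898) and `DiluteOfCoercive` (stmt-11276) are attached to those
  items as evidence (a refuter cannot land positive items).
* Compute: toy probe `j009655` (2D quenched U(1), Wilson `r = 1` Dirichlet cells `s = 4, 8, 16`,
  `β = 2, 4, 8`: small-ball law of `s·σ_min(S_Σ)`, sign-defect / negative-determinant frequencies,
  crossing-mass histograms) queued at the time of writing; results to be folded into Part D.
* Part C — WITHOUT THE PIN THE CRUX IS TRIVIAL: `CoerciveSeaWithoutPin` (clauses (i) ∧ (ii) only)
  holds with the junk witness `mcrit ≡ 1` — so all non-trivial content of the hinge enters through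
  (iii); any proof must use the pin to locate `mcrit` on the physical branch.
* Part D — quantitative margins / threats (docstring `physicsMargins`), near-misses.
* CYCLE 2 (seat -g2-0):
  * Part E — THE PIN IS SELF-SUFFICIENT (rigorous): `PinClause.tendsto_a_div_Zm` (pin alone ⇒
    `a_k/Z_m k → 0`, no `HasMassScaling`, every `N_f`), `PinClause.mcrit_lt_eventually`
    (`limsup mcrit ≤ 0`), `PinClause.neg_eight_lt_mcrit_eventually`, `CoerciveSeaAt.pin_asymptotics`,
    `not_coerciveSeaAt_of_frequently_pos` / `heavyJunk_dichotomy_all` (heavy corner dead for every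
    `N_f`). LANDED: `Theorems/CoerciveSea/Negative/PinSelfSufficiency.lean` (p83270, ACCEPTED;
    `import Summits.QuantumFields.QCD.Theorems.CoerciveSea.Negative.PinSelfSufficiency`).
  * Part F — RESOLUTION OF CLAUSE (i) (rigorous): on every window box the valence offset is
    eventually below `η/s` for every `η > 0` (`valenceOffset_lt_div_side_eventually`,
    `CoerciveSeaAt.valence_within_resolution`): at the threshold `t/s₀` of (i) the valence mass, the
    critical line and every pin probe coincide — (i) is a statement AT the critical line.
  * Part G — deterministic cell facts: `wilsonCell_mass_shift`, `exists_pseudomode_of_det_eq_zero`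
    (a crossing at `μ'` is an exact `|μ−μ'|`-pseudomode at every mass), `cell_nearSingular_of_crossing`
    (lower-bound direction for a CELL Wegner law), `crossing_above_and_below_of_neg` (a negative cell
    is bracketed by crossings in `(μ,0]` AND `[−8,μ)`). LANDED: `Theorems/CoerciveSea/Negative/
    CrossingBracket.lean` (p83881, ACCEPTED).
  * Part D' — cycle-2 margins (docstring `physicsMarginsCycle2`): resolution numbers, separator
    steepness `S_Σ' = 1 + D_ΣI D_II⁻² D_IΣ`, the pin-vs-(i) consistency count `(ℓ/R)⁴/4` and the
    instanton floor `α_cell ≤ (b−4)/2`, KVZ random-matrix densities of real Wilson modes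
    (arXiv:1109.0656 p. 4) against the `S → ∞` lever, toy j013303.
-/
noncomputable section

open scoped BigOperators ComplexConjugate Kronecker
open MeasureTheory Filter Matrix
open Literature.MathematicalPhysics.QuantumLattice Literature.MathematicalPhysics.QuantumFieldTheory
  Literature.Probability.LatticeModels

namespace Summit.QuantumFields.QCD.Cruxes.CoerciveSea.Disproof

/-! ## Part A.1 — Seiler positivity on both sides: `Re det D_W(U,m,1) > 0` for `|m + 4| > 4` -/

section DetPos

variable {L N : ℕ} [NeZero L] {G : Type*} [Group G] (ρ : G →* Matrix (Fin N) (Fin N) ℂ)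

section L2

open scoped Matrix.Norms.L2Operator

/-- Neumann: for `|m+4| > 4` and `t ∈ [0,1]` the homotopy matrix `1 − (t/(m+4)) K` is a unit
(`‖K‖ ≤ 4`). [folklore] -/
theorem isUnit_segMatrix_of_four_lt_abs (hρ : ∀ g, ρ g ∈ Matrix.unitaryGroup (Fin N) ℂ)
    (U : GaugeConfig 4 L G) {m t : ℝ} (hm : 4 < |m + 4|) (ht0 : 0 ≤ t) (ht1 : t ≤ 1) :
    IsUnit ((1 - ((t / (m + 4) : ℝ) : ℂ) • ∑ μ, wilsonHop ρ U μ)) := by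
  have hK := l2_opNorm_sum_wilsonHop_le ρ hρ U
  have h4 : (0 : ℝ) < |m + 4| := by linarith
  have hnorm : ‖((t / (m + 4) : ℝ) : ℂ) • ∑ μ, wilsonHop ρ U μ‖ < 1 := by
    rw [norm_smul, Complex.norm_real, Real.norm_eq_abs, abs_div, abs_of_nonneg ht0]
    calc t / |m + 4| * ‖∑ μ, wilsonHop ρ U μ‖ ≤ 1 / |m + 4| * 4 := by
          apply mul_le_mul _ hK (norm_nonneg _) (by positivity)
          exact div_le_div_of_nonneg_right ht1 h4.le
      _ < 1 := by
          rw [div_mul_eq_mul_div, one_mul, div_lt_one h4]; exact hm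
  exact ⟨Units.oneSub _ hnorm, rfl⟩

/-- Hence `det (1 − (t/(m+4)) K) ≠ 0` on the segment. [folklore] -/
theorem det_segMatrix_ne_zero_of_four_lt_abs (hρ : ∀ g, ρ g ∈ Matrix.unitaryGroup (Fin N) ℂ)
    (U : GaugeConfig 4 L G) {m t : ℝ} (hm : 4 < |m + 4|) (ht0 : 0 ≤ t) (ht1 : t ≤ 1) :
    ((1 - ((t / (m + 4) : ℝ) : ℂ) • ∑ μ, wilsonHop ρ U μ)).det ≠ 0 :=
  ((Matrix.isUnit_iff_isUnit_det _).mp (isUnit_segMatrix_of_four_lt_abs ρ hρ U hm ht0 ht1)).ne_zero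

end L2

omit [NeZero L] in
/-- For `t ≠ 0`, `m + 4 ≠ 0` the homotopy matrix is `t/(m+4)` times the Wilson–Dirac matrix at
bare mass `(m+4)/t − 4`. [folklore] -/
theorem segMatrix_eq_smul_wilsonDirac' (hρ : ∀ g, ρ g ∈ Matrix.unitaryGroup (Fin N) ℂ)
    (U : GaugeConfig 4 L G) {m t : ℝ} (hm : m + 4 ≠ 0) (ht : t ≠ 0) :
    (1 - ((t / (m + 4) : ℝ) : ℂ) • ∑ μ, wilsonHop ρ U μ) =
      ((t / (m + 4) : ℝ) : ℂ) • wilsonDirac ρ U ((m + 4) / t - 4) 1 := by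
  rw [wilsonDirac_eq_sub_sum_wilsonHop ρ hρ, smul_sub, smul_smul, ← Complex.ofReal_mul,
    show t / (m + 4) * ((m + 4) / t - 4 + 4) = 1 by field_simp; ring, Complex.ofReal_one, one_smul]

/-- `det (1 − (t/(m+4)) K)` is real (γ₅-hermiticity at the rescaled mass; `= 1` at `t = 0`).
[folklore] -/
theorem det_segMatrix_im' (hρ : ∀ g, ρ g ∈ Matrix.unitaryGroup (Fin N) ℂ)
    (U : GaugeConfig 4 L G) {m t : ℝ} (hm : m + 4 ≠ 0) :
    (((1 - ((t / (m + 4) : ℝ) : ℂ) • ∑ μ, wilsonHop ρ U μ)).det).im = 0 := by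
  rcases eq_or_ne t 0 with h | ht
  · subst h; simp
  · rw [segMatrix_eq_smul_wilsonDirac' ρ hρ U hm ht, det_smul]
    have hreal := fermionDet_wilsonDirac_im_holds (L := L) ρ hρ U ((m + 4) / t - 4) 1
    set d := (wilsonDirac ρ U ((m + 4) / t - 4) 1).det with hd
    have hd' : d = ((d.re : ℝ) : ℂ) := Complex.ext (by simp) (by simpa using hreal)
    rw [hd', ← Complex.ofReal_pow, ← Complex.ofReal_mul, Complex.ofReal_im]

/-- The Wilson index set `sites × colours × spins` has EVEN cardinality (four spins). [folklore] -/
theorem even_card_wilsonIndex :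
    Even (Fintype.card (TorusSite 4 L × Fin N × Fin 4)) := by
  rw [Fintype.card_prod, Fintype.card_prod, Fintype.card_fin]
  exact (show Even 4 from ⟨2, rfl⟩).mul_left _ |>.mul_left _

/-- **Seiler positivity on both sides of the hopping band.** For every unitary colour
representation, every periodic four-torus, every gauge field and every bare mass with
`|m + 4| > 4` — i.e. `m > 0` (the tree's `fermionDet_wilsonDirac_re_pos`) OR `m < −8` — the Wilson
determinant is a positive real: along `t ↦ 1 − (t/(m+4))K` the determinant is real, continuous,
non-zero (Neumann, `‖K‖ ≤ 4 < |m+4|`) and `1` at `t = 0`, so positive at `t = 1`; and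
`det D_W = (m+4)^n det(1 − K/(m+4))` with `n = #sites·N·4` EVEN, so `(m+4)^n > 0` also for
`m + 4 < 0`. Consequence for the crux: the pin event `Re det D_W(U, μ₀, 1) < 0` is EMPTY unless
`μ₀ ∈ [−8, 0]`. [folklore] -/
theorem fermionDet_wilsonDirac_re_pos_of_four_lt_abs (hρ : ∀ g, ρ g ∈ Matrix.unitaryGroup (Fin N) ℂ)
    (U : GaugeConfig 4 L G) {m : ℝ} (hm : 4 < |m + 4|) :
    0 < (fermionDet (wilsonDirac ρ U m 1)).re := by
  have hm4 : m + 4 ≠ 0 := fun h => by rw [h, abs_zero] at hm; linarith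
  set g : ℝ → ℝ := fun t => (((1 - ((t / (m + 4) : ℝ) : ℂ) • ∑ μ, wilsonHop ρ U μ)).det).re
    with hgdef
  have hg : Continuous g := Complex.continuous_re.comp (continuous_det_segMatrix ρ U m)
  have hg0 : g 0 = 1 := by simp [hgdef]
  have hne : ∀ t ∈ Set.Icc (0 : ℝ) 1, g t ≠ 0 := by
    intro t ht h0
    apply det_segMatrix_ne_zero_of_four_lt_abs ρ hρ U hm ht.1 ht.2
    exact Complex.ext (by simpa [hgdef] using h0) (by simpa using det_segMatrix_im' ρ hρ U hm4)
  have hg1 : 0 < g 1 := by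
    refine lt_of_not_ge fun hle => ?_
    have hmem : (0 : ℝ) ∈ Set.Icc (g 1) (g 0) := ⟨hle, by rw [hg0]; norm_num⟩
    obtain ⟨t, ht, ht0⟩ := intermediate_value_Icc' zero_le_one hg.continuousOn hmem
    exact hne t ht ht0
  have hD : wilsonDirac ρ U m 1 =
      ((m + 4 : ℝ) : ℂ) • (1 - ((1 / (m + 4) : ℝ) : ℂ) • ∑ μ, wilsonHop ρ U μ) := by
    rw [smul_sub, smul_smul, ← Complex.ofReal_mul,
      show (m + 4) * (1 / (m + 4)) = 1 by field_simp, Complex.ofReal_one, one_smul,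
      wilsonDirac_eq_sub_sum_wilsonHop ρ hρ]
  have hdet : fermionDet (wilsonDirac ρ U m 1) =
      (((m + 4) ^ Fintype.card (TorusSite 4 L × Fin N × Fin 4) * g 1 : ℝ) : ℂ) := by
    rw [fermionDet, hD, det_smul]
    have him := det_segMatrix_im' ρ hρ U (t := 1) hm4
    set d := ((1 - ((1 / (m + 4) : ℝ) : ℂ) • ∑ μ, wilsonHop ρ U μ)).det with hd
    have hd' : d = ((d.re : ℝ) : ℂ) := Complex.ext (by simp) (by simpa using him)
    rw [hd', ← Complex.ofReal_pow, ← Complex.ofReal_mul]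
  rw [hdet, Complex.ofReal_re]
  exact mul_pos (even_card_wilsonIndex.pow_pos hm4) hg1

/-- The two corners in one statement: `m > 0 ∨ m < −8` gives a positive determinant. [folklore] -/
theorem fermionDet_wilsonDirac_re_pos_of_pos_or_lt (hρ : ∀ g, ρ g ∈ Matrix.unitaryGroup (Fin N) ℂ)
    (U : GaugeConfig 4 L G) {m : ℝ} (hm : 0 < m ∨ m < -8) :
    0 < (fermionDet (wilsonDirac ρ U m 1)).re := by
  refine fermionDet_wilsonDirac_re_pos_of_four_lt_abs ρ hρ U ?_
  rcases hm with h | h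
  · rw [abs_of_pos (by linarith)]; linarith
  · rw [abs_of_neg (by linarith)]; linarith

end DetPos


/-! ## Part B — cell level: compression, coercivity, near-singular separators, real and positive Dirichlet determinants -/

/-! ## Part B — cell level: compression, coercivity, near-singular separators, real and positive Dirichlet determinants -/


/-! ### B.0 generic: zero extension (`Function.extend Subtype.val v 0`) and compression -/

section Generic

variable {n : Type*} [Fintype n] (p : n → Prop) [DecidablePred p]

omit [Fintype n] [DecidablePred p] in
/-- The zero extension `Function.extend Subtype.val v 0` restricts back to `v`. [folklore] -/
theorem extend_val_apply (v : {a // p a} → ℂ) (a : {a // p a}) :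
    Function.extend Subtype.val v 0 (a : n) = v a :=
  Subtype.val_injective.extend_apply _ _ _

omit [Fintype n] [DecidablePred p] in
/-- The zero extension vanishes off the subtype. [folklore] -/
theorem extend_val_of_not (v : {a // p a} → ℂ) {b : n} (hb : ¬ p b) :
    Function.extend Subtype.val v 0 b = 0 := by
  rw [Function.extend_apply']
  · rfl
  · rintro ⟨a, rfl⟩; exact hb a.2

/-- Sums of functions vanishing at `0` over the zero extension reduce to the subtype. [folklore] -/
theorem sum_extend_val {M : Type*} [AddCommMonoid M] (v : {a // p a} → ℂ) (F : n → ℂ → M)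
    (hF : ∀ b, F b 0 = 0) :
    ∑ b, F b (Function.extend Subtype.val v 0 b) = ∑ a : {a // p a}, F a (v a) := by
  rw [← Fintype.sum_subtype_add_sum_subtype p (fun b => F b (Function.extend Subtype.val v 0 b))]
  have h0 : ∑ a : {a // ¬ p a}, F a (Function.extend Subtype.val v 0 a) = 0 :=
    Finset.sum_eq_zero fun a _ => by rw [extend_val_of_not p v a.2, hF]
  simp only [extend_val_apply, h0, add_zero]

/-- The compressed matrix acts on `v` as the full matrix acts on the zero extension. [folklore] -/
theorem toSquareBlockProp_mulVec (M : Matrix n n ℂ) (v : {a // p a} → ℂ) (i : {a // p a}) :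
    (M.toSquareBlockProp p *ᵥ v) i = (M *ᵥ Function.extend Subtype.val v 0) i := by
  simp only [Matrix.mulVec, dotProduct, toSquareBlockProp_def, Matrix.of_apply]
  rw [sum_extend_val p v (fun b z => M i b * z) (fun b => mul_zero _)]

omit [Fintype n] [DecidablePred p] in
/-- Compression is linear and unital: `(c•1 − K)_c = c•1 − K_c`. [folklore] -/
theorem toSquareBlockProp_smul_one_sub [DecidableEq n] (c : ℂ) (K : Matrix n n ℂ) :
    (c • (1 : Matrix n n ℂ) - K).toSquareBlockProp p = c • 1 - K.toSquareBlockProp p := by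
  ext i j
  simp only [toSquareBlockProp_def, Matrix.of_apply, Matrix.sub_apply, Matrix.smul_apply,
    Matrix.one_apply, Subtype.val_inj]

end Generic

/-! ### B.1 coercivity of the hopping form, full index and compressed -/

section Hop

variable {L N : ℕ} [NeZero L] {G : Type*} [Group G] (ρ : G →* Matrix (Fin N) (Fin N) ℂ)

open scoped Matrix.Norms.L2Operator in
/-- `|⟨ψ, K ψ⟩| ≤ 4 ‖ψ‖²` for the Wilson hopping sum `K = Σ_μ W_μ` (`‖K‖ ≤ 4`). [folklore] -/
theorem norm_inner_hop_le (hρ : ∀ g, ρ g ∈ Matrix.unitaryGroup (Fin N) ℂ) (U : GaugeConfig 4 L G)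
    (ψ : TorusSite 4 L × Fin N × Fin 4 → ℂ) :
    ‖∑ i, conj (ψ i) * ((∑ μ, wilsonHop ρ U μ) *ᵥ ψ) i‖ ≤ 4 * ∑ i, ‖ψ i‖ ^ 2 := by
  set K := ∑ μ, wilsonHop ρ U μ with hKdef
  have hK : ‖K‖ ≤ 4 := l2_opNorm_sum_wilsonHop_le ρ hρ U
  have h1 : ∑ i, ‖(K *ᵥ ψ) i‖ ^ 2 ≤ ‖K‖ ^ 2 * ∑ i, ‖ψ i‖ ^ 2 := sum_norm_sq_mulVec_le K ψ
  have hn : 0 ≤ ∑ i, ‖ψ i‖ ^ 2 := Finset.sum_nonneg fun i _ => by positivity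
  have h2 : ∑ i, ‖(K *ᵥ ψ) i‖ ^ 2 ≤ 16 * ∑ i, ‖ψ i‖ ^ 2 := h1.trans (by
    apply mul_le_mul_of_nonneg_right _ hn
    nlinarith [norm_nonneg K])
  have hA : 0 ≤ ∑ i, ‖ψ i‖ * ‖(K *ᵥ ψ) i‖ := Finset.sum_nonneg fun i _ => by positivity
  have hcs := Finset.sum_mul_sq_le_sq_mul_sq Finset.univ (fun i => ‖ψ i‖) (fun i => ‖(K *ᵥ ψ) i‖)
  have h3 : (∑ i, ‖ψ i‖ * ‖(K *ᵥ ψ) i‖) ^ 2 ≤ (4 * ∑ i, ‖ψ i‖ ^ 2) ^ 2 :=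
    calc (∑ i, ‖ψ i‖ * ‖(K *ᵥ ψ) i‖) ^ 2 ≤ (∑ i, ‖ψ i‖ ^ 2) * ∑ i, ‖(K *ᵥ ψ) i‖ ^ 2 := hcs
      _ ≤ (∑ i, ‖ψ i‖ ^ 2) * (16 * ∑ i, ‖ψ i‖ ^ 2) := by gcongr
      _ = (4 * ∑ i, ‖ψ i‖ ^ 2) ^ 2 := by ring
  have h4 : ∑ i, ‖ψ i‖ * ‖(K *ᵥ ψ) i‖ ≤ 4 * ∑ i, ‖ψ i‖ ^ 2 :=
    (pow_le_pow_iff_left₀ hA (by positivity) two_ne_zero).mp h3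
  calc ‖∑ i, conj (ψ i) * (K *ᵥ ψ) i‖ ≤ ∑ i, ‖conj (ψ i) * (K *ᵥ ψ) i‖ := norm_sum_le _ _
    _ = ∑ i, ‖ψ i‖ * ‖(K *ᵥ ψ) i‖ := by simp
    _ ≤ 4 * ∑ i, ‖ψ i‖ ^ 2 := h4

/-- The same bound for the hopping sum COMPRESSED to any index subset (zero extension). [folklore] -/
theorem norm_inner_hop_compressed_le (hρ : ∀ g, ρ g ∈ Matrix.unitaryGroup (Fin N) ℂ)
    (U : GaugeConfig 4 L G) (p : TorusSite 4 L × Fin N × Fin 4 → Prop) [DecidablePred p]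
    (v : {a // p a} → ℂ) :
    ‖∑ a, conj (v a) * (((∑ μ, wilsonHop ρ U μ).toSquareBlockProp p) *ᵥ v) a‖ ≤
      4 * ∑ a, ‖v a‖ ^ 2 := by
  have h := norm_inner_hop_le ρ hρ U (Function.extend Subtype.val v 0)
  rw [sum_extend_val p v (fun _ z => ‖z‖ ^ 2) (by simp),
    sum_extend_val p v (fun b z => conj z *
      ((∑ μ, wilsonHop ρ U μ) *ᵥ Function.extend Subtype.val v 0) b) (by simp)] at h
  simpa only [toSquareBlockProp_mulVec] using h

/-- **Coercivity of compressed Wilson–Dirac matrices**: for every index subset `p`, every vector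
`v` on it and every bare mass `μ`, `Re ⟨v, D_c v⟩ ≥ μ ‖v‖²` (`D_c = (μ+4)·1 − K_c`, `‖K‖ ≤ 4`).
This is the `μ ≥ 0` shadow of route item `KineticEdge`. [folklore] -/
theorem re_inner_compressed_ge (hρ : ∀ g, ρ g ∈ Matrix.unitaryGroup (Fin N) ℂ)
    (U : GaugeConfig 4 L G) (μ : ℝ) (p : TorusSite 4 L × Fin N × Fin 4 → Prop) [DecidablePred p]
    (v : {a // p a} → ℂ) :
    μ * ∑ a, ‖v a‖ ^ 2 ≤
      (∑ a, conj (v a) * (((wilsonDirac ρ U μ 1).toSquareBlockProp p) *ᵥ v) a).re := by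
  rw [wilsonDirac_eq_sub_sum_wilsonHop ρ hρ, toSquareBlockProp_smul_one_sub, Matrix.sub_mulVec,
    Matrix.smul_mulVec, Matrix.one_mulVec]
  simp only [Pi.sub_apply, Pi.smul_apply, smul_eq_mul, mul_sub, Finset.sum_sub_distrib,
    Complex.sub_re]
  have h1 : (∑ a, conj (v a) * (((μ + 4 : ℝ) : ℂ) * v a)).re = (μ + 4) * ∑ a, ‖v a‖ ^ 2 := by
    have : ∑ a, conj (v a) * (((μ + 4 : ℝ) : ℂ) * v a) = (((μ + 4) * ∑ a, ‖v a‖ ^ 2 : ℝ) : ℂ) := by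
      rw [Complex.ofReal_mul, Complex.ofReal_sum, Finset.mul_sum]
      refine Finset.sum_congr rfl fun a _ => ?_
      rw [mul_left_comm, Complex.conj_mul' (v a)]
      push_cast; ring
    rw [this, Complex.ofReal_re]
  have h2 := (Complex.re_le_norm _).trans (norm_inner_hop_compressed_le ρ hρ U p v)
  rw [h1]
  linarith

end Hop

/-! ### B.2 near-singular separators need `μ < τ` -/

/-- **A `τ`-singular separator forces `μ < |τ|`.** If the corner-`0` box of sides `s` has a
`τ`-singular separator at bare mass `μ` (`HasSingularSeparator U μ s τ`: a vector `w`, harmonic on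
the children interiors, non-zero on the separator, with separator residual `< τ² ×` separator
mass), then `μ < |τ|`: by harmonicity the separator residual is the FULL residual `‖D_c w‖²`, by
coercivity `μ‖w‖² ≤ Re⟨w, D_c w⟩ ≤ ‖w‖ ‖D_c w‖ < |τ| ‖w‖ ‖w_Σ‖ ≤ |τ| ‖w‖²`. In clause (i) of
`CoerciveSea` the level is `τ = t/s₀ ≤ 1/2`, so at valence masses `μ ≥ 1/2` the event is EMPTY
for every gauge field — the clause is vacuous in the heavy junk corner. [folklore] -/
theorem hasSingularSeparator_mass_lt {Nt : ℕ} [NeZero Nt] {U : GaugeConfig 4 Nt (Matrix.specialUnitaryGroup (Fin 3) ℂ)} {μ τ : ℝ}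
    {s : Fin 4 → ℕ} (h : HasSingularSeparator U μ s τ) : μ < |τ| := by
  obtain ⟨w, ⟨p₀, -, hw₀⟩, hharm, hres⟩ := h
  set Dc := wilsonCell U μ 0 s with hDc
  set n2 := ∑ p, ‖w p‖ ^ 2 with hn2
  have hn2_pos : 0 < n2 := by
    have hw₀' : 0 < ‖w p₀‖ := norm_pos_iff.mpr hw₀
    exact Finset.sum_pos' (fun p _ => by positivity) ⟨p₀, Finset.mem_univ _, by positivity⟩
  have hRfull : ∑ p, ‖(Dc *ᵥ w) p‖ ^ 2 =
      ∑ p, (if childrenInterior s p then 0 else ‖(Dc *ᵥ w) p‖ ^ 2) := by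
    refine Finset.sum_congr rfl fun p _ => ?_
    split_ifs with hp
    · rw [hharm p hp]; simp
    · rfl
  have hsep_le : ∑ p, (if childrenInterior s p then 0 else ‖w p‖ ^ 2) ≤ n2 :=
    Finset.sum_le_sum fun p _ => by
      split_ifs
      · positivity
      · exact le_rfl
  have hR2 : ∑ p, ‖(Dc *ᵥ w) p‖ ^ 2 < τ ^ 2 * n2 := by
    rw [hRfull]; exact hres.trans_le (mul_le_mul_of_nonneg_left hsep_le (sq_nonneg τ))
  have hco := re_inner_compressed_ge (fundamentalRep (Fin 3)) fundamentalRep_mem_unitaryGroup U μ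
    (wilsonBox 0 s) w
  change μ * n2 ≤ (∑ p, conj (w p) * (Dc *ᵥ w) p).re at hco
  set A := ∑ p, ‖w p‖ * ‖(Dc *ᵥ w) p‖ with hA
  have hA1 : (∑ p, conj (w p) * (Dc *ᵥ w) p).re ≤ A := by
    refine (Complex.re_le_norm _).trans ((norm_sum_le _ _).trans (le_of_eq ?_))
    simp [A]
  have hA2 : A ^ 2 ≤ n2 * ∑ p, ‖(Dc *ᵥ w) p‖ ^ 2 := Finset.sum_mul_sq_le_sq_mul_sq _ _ _
  by_contra hle
  push Not at hle
  have hμ0 : 0 ≤ μ := (abs_nonneg τ).trans hle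
  have h1 : μ * n2 ≤ A := hco.trans hA1
  have h2 : (μ * n2) ^ 2 ≤ A ^ 2 := pow_le_pow_left₀ (by positivity) h1 2
  have h3 : A ^ 2 < n2 * (τ ^ 2 * n2) := hA2.trans_lt (mul_lt_mul_of_pos_left hR2 hn2_pos)
  have h4 : τ ^ 2 ≤ μ ^ 2 := by
    calc τ ^ 2 = |τ| ^ 2 := (sq_abs τ).symm
      _ ≤ μ ^ 2 := pow_le_pow_left₀ (abs_nonneg τ) hle 2
  have h5 : n2 * (τ ^ 2 * n2) ≤ (μ * n2) ^ 2 := by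
    have := mul_le_mul_of_nonneg_right h4 (sq_nonneg n2)
    nlinarith
  linarith



/-! ### B.3 Dirichlet cell determinants are real (γ₅-hermiticity restricted) -/

section DetReal

variable {L N : ℕ} [NeZero L] {G : Type*} [Group G] (ρ : G →* Matrix (Fin N) (Fin N) ℂ)

omit [NeZero L] [Group G] in
/-- Chirality signs `γ₅ = diag(1,1,−1,−1)` square to one. [folklore] -/
theorem chiSign_sq (k : Fin 4) : (![1, 1, -1, -1] : Fin 4 → ℂ) k * (![1, 1, -1, -1] : Fin 4 → ℂ) k = 1 := by
  fin_cases k <;> simp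

omit [NeZero L] in
/-- `Γ₅ = spinorLift γ₅` is the diagonal matrix of chirality signs (read off the spin index). [folklore] -/
theorem spinorLift_gammaFive :
    (spinorLift gammaFive : Matrix (TorusSite 4 L × Fin N × Fin 4) _ ℂ) =
      diagonal fun q => (![1, 1, -1, -1] : Fin 4 → ℂ) q.2.2 := by
  ext p q
  rcases p with ⟨x, a, α⟩
  rcases q with ⟨y, b, β⟩
  simp only [spinorLift, gammaFive_eq_diagonal, Matrix.kroneckerMap_apply, Matrix.one_apply,
    Matrix.diagonal_apply, Prod.mk.injEq]
  by_cases hx : x = y <;> by_cases ha : a = b <;> by_cases hα : α = β <;> simp [hx, ha, hα]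

/-- γ₅-hermiticity entrywise: `conj D_{ji} = χ_i D_{ij} χ_j`, `χ` the chirality sign of the spin
index. [folklore] -/
theorem conj_wilsonDirac_apply (hρ : ∀ g, ρ g ∈ Matrix.unitaryGroup (Fin N) ℂ)
    (U : GaugeConfig 4 L G) (m : ℝ) (i j : TorusSite 4 L × Fin N × Fin 4) :
    conj (wilsonDirac ρ U m 1 j i) =
      (![1, 1, -1, -1] : Fin 4 → ℂ) i.2.2 * wilsonDirac ρ U m 1 i j * (![1, 1, -1, -1] : Fin 4 → ℂ) j.2.2 := by
  have h := wilsonDirac_gammaFive_hermitian_holds (L := L) ρ hρ U m 1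
  rw [spinorLift_gammaFive] at h
  have hij := congrFun (congrFun h i) j
  rw [Matrix.mul_diagonal, Matrix.diagonal_mul, Matrix.conjTranspose_apply] at hij
  rw [hij]
  rfl

/-- **Every principal submatrix of the Wilson–Dirac matrix has real determinant** (the substance
of route item `DirichletDetReal`, for an ARBITRARY index subset, not only site sets): the
compressed matrix is again `Γ₅`-hermitian because `Γ₅` is diagonal, so `conj det = det`. [folklore] -/
theorem det_compressed_im (hρ : ∀ g, ρ g ∈ Matrix.unitaryGroup (Fin N) ℂ)
    (U : GaugeConfig 4 L G) (m : ℝ) (p : TorusSite 4 L × Fin N × Fin 4 → Prop) [DecidablePred p] :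
    (((wilsonDirac ρ U m 1).toSquareBlockProp p).det).im = 0 := by
  set Dc := (wilsonDirac ρ U m 1).toSquareBlockProp p with hDc
  set Γc : Matrix {a // p a} {a // p a} ℂ :=
    diagonal fun a => (![1, 1, -1, -1] : Fin 4 → ℂ) a.1.2.2 with hΓc
  have hherm : Dcᴴ = Γc * Dc * Γc := by
    ext i j
    rw [Matrix.conjTranspose_apply, hΓc, Matrix.mul_diagonal, Matrix.diagonal_mul, hDc,
      toSquareBlockProp_def, Matrix.of_apply, Matrix.of_apply]
    exact conj_wilsonDirac_apply ρ hρ U m i j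
  have hΓdet : Γc.det * Γc.det = 1 := by
    rw [hΓc, det_diagonal, ← Finset.prod_mul_distrib]
    exact Finset.prod_eq_one fun a _ => chiSign_sq a.1.2.2
  have hstar : star Dc.det = Dc.det := by
    rw [← det_conjTranspose, hherm, det_mul, det_mul]
    linear_combination Dc.det * hΓdet
  exact Complex.conj_eq_iff_im.mp hstar

end DetReal

/-! ### B.4 Dirichlet cell determinants are positive off the hopping band `|μ+4| ≤ 4` -/

section DetPos

variable {L N : ℕ} [NeZero L] {G : Type*} [Group G] (ρ : G →* Matrix (Fin N) (Fin N) ℂ)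

/-- Index subsets cut out by a SITE predicate (boxes, site sets) have even cardinality
(`N` colours × 4 spins per site). [folklore] -/
theorem even_card_sitePred (P : TorusSite 4 L → Prop) [DecidablePred P] :
    Even (Fintype.card {q : TorusSite 4 L × Fin N × Fin 4 // P q.1}) := by
  rw [Fintype.card_congr (Equiv.prodSubtypeFstEquivSubtypeProd (p := P) (β := Fin N × Fin 4)),
    Fintype.card_prod, Fintype.card_prod, Fintype.card_fin, Fintype.card_fin]
  exact ((show Even 4 from ⟨2, rfl⟩).mul_left N).mul_left _

/-- The cell homotopy matrix `1 − (t/(μ+4)) K_c` has non-zero determinant for `|μ+4| > 4`,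
`t ∈ [0,1]`: a kernel vector would give `‖v‖² = (t/(μ+4)) Re⟨v, K_c v⟩ ≤ (4t/|μ+4|)‖v‖² < ‖v‖²`.
[folklore] -/
theorem det_cellSeg_ne_zero (hρ : ∀ g, ρ g ∈ Matrix.unitaryGroup (Fin N) ℂ) (U : GaugeConfig 4 L G)
    (p : TorusSite 4 L × Fin N × Fin 4 → Prop) [DecidablePred p] {μ t : ℝ} (hμ : 4 < |μ + 4|)
    (ht0 : 0 ≤ t) (ht1 : t ≤ 1) :
    ((1 : Matrix {a // p a} {a // p a} ℂ) -
        ((t / (μ + 4) : ℝ) : ℂ) • (∑ ν, wilsonHop ρ U ν).toSquareBlockProp p).det ≠ 0 := by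
  intro hdet
  obtain ⟨v, hv, hKv⟩ := Matrix.exists_mulVec_eq_zero_iff.mpr hdet
  set Kc := (∑ ν, wilsonHop ρ U ν).toSquareBlockProp p with hKc
  set n2 := ∑ a, ‖v a‖ ^ 2 with hn2
  have hn2_pos : 0 < n2 := by
    obtain ⟨a, ha⟩ : ∃ a, v a ≠ 0 := by
      by_contra hall; push Not at hall; exact hv (funext hall)
    have ha' : 0 < ‖v a‖ := norm_pos_iff.mpr ha
    exact Finset.sum_pos' (fun a _ => by positivity) ⟨a, Finset.mem_univ _, by positivity⟩
  -- 0 = Σ conj(v) ((1 - c Kc) v) = n2 - c Σ conj v (Kc v)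
  have hsum : ∑ a, conj (v a) * (((1 : Matrix _ _ ℂ) - ((t / (μ + 4) : ℝ) : ℂ) • Kc) *ᵥ v) a = 0 := by
    rw [hKv]; simp
  rw [Matrix.sub_mulVec, Matrix.smul_mulVec, Matrix.one_mulVec] at hsum
  simp only [Pi.sub_apply, Pi.smul_apply, smul_eq_mul, mul_sub, Finset.sum_sub_distrib] at hsum
  have h1 : ∑ a, conj (v a) * v a = ((n2 : ℝ) : ℂ) := by
    rw [hn2, Complex.ofReal_sum]
    exact Finset.sum_congr rfl fun a _ => by rw [Complex.conj_mul' (v a)]; push_cast; ring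
  have h2 : ∑ a, conj (v a) * (((t / (μ + 4) : ℝ) : ℂ) * (Kc *ᵥ v) a) =
      ((t / (μ + 4) : ℝ) : ℂ) * ∑ a, conj (v a) * (Kc *ᵥ v) a := by
    rw [Finset.mul_sum]; exact Finset.sum_congr rfl fun a _ => by ring
  rw [h1, h2, sub_eq_zero] at hsum
  have hb := norm_inner_hop_compressed_le ρ hρ U p v
  rw [← hKc] at hb
  have h4pos : (0 : ℝ) < |μ + 4| := by linarith
  have hnorm := congrArg (fun z : ℂ => ‖z‖) hsum
  simp only [Complex.norm_real, Real.norm_eq_abs, norm_mul, abs_div] at hnorm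
  rw [abs_of_pos hn2_pos, abs_of_nonneg ht0] at hnorm
  have : n2 ≤ t / |μ + 4| * (4 * n2) :=
    calc n2 = _ := hnorm
      _ ≤ t / |μ + 4| * (4 * n2) := mul_le_mul_of_nonneg_left hb (by positivity)
  have hlt : t / |μ + 4| * 4 < 1 := by
    rw [div_mul_eq_mul_div, div_lt_one h4pos]; nlinarith
  nlinarith

omit [NeZero L] in
/-- For `t ≠ 0` the cell homotopy matrix is `t/(μ+4)` times the compressed Wilson–Dirac matrix
at bare mass `(μ+4)/t − 4`. [folklore] -/
theorem cellSeg_eq_smul (hρ : ∀ g, ρ g ∈ Matrix.unitaryGroup (Fin N) ℂ) (U : GaugeConfig 4 L G)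
    (p : TorusSite 4 L × Fin N × Fin 4 → Prop) [DecidablePred p] {μ t : ℝ} (hμ : μ + 4 ≠ 0)
    (ht : t ≠ 0) :
    ((1 : Matrix {a // p a} {a // p a} ℂ) -
        ((t / (μ + 4) : ℝ) : ℂ) • (∑ ν, wilsonHop ρ U ν).toSquareBlockProp p) =
      ((t / (μ + 4) : ℝ) : ℂ) • (wilsonDirac ρ U ((μ + 4) / t - 4) 1).toSquareBlockProp p := by
  rw [wilsonDirac_eq_sub_sum_wilsonHop ρ hρ, toSquareBlockProp_smul_one_sub, smul_sub, smul_smul,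
    ← Complex.ofReal_mul, show t / (μ + 4) * ((μ + 4) / t - 4 + 4) = 1 by field_simp; ring,
    Complex.ofReal_one, one_smul]

/-- `det` of the cell homotopy matrix is real. [folklore] -/
theorem det_cellSeg_im (hρ : ∀ g, ρ g ∈ Matrix.unitaryGroup (Fin N) ℂ) (U : GaugeConfig 4 L G)
    (p : TorusSite 4 L × Fin N × Fin 4 → Prop) [DecidablePred p] {μ t : ℝ} (hμ : μ + 4 ≠ 0) :
    (((1 : Matrix {a // p a} {a // p a} ℂ) -
        ((t / (μ + 4) : ℝ) : ℂ) • (∑ ν, wilsonHop ρ U ν).toSquareBlockProp p).det).im = 0 := by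
  rcases eq_or_ne t 0 with h | ht
  · subst h; simp
  · rw [cellSeg_eq_smul ρ hρ U p hμ ht, det_smul]
    have hreal := det_compressed_im ρ hρ U ((μ + 4) / t - 4) p
    set d := ((wilsonDirac ρ U ((μ + 4) / t - 4) 1).toSquareBlockProp p).det with hd
    have hd' : d = ((d.re : ℝ) : ℂ) := Complex.ext (by simp) (by simpa using hreal)
    rw [hd', ← Complex.ofReal_pow, ← Complex.ofReal_mul, Complex.ofReal_im]

/-- **Dirichlet cell determinants are positive off the hopping band.** For a SITE predicate `P`
(any box / site set), every gauge field and every bare mass with `|μ + 4| > 4` (`μ > 0` or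
`μ < −8`), `Re det (D_W)_c > 0` for the principal submatrix on `{q | P q.site}`: homotopy
`t ↦ 1 − (t/(μ+4))K_c` (non-singular by coercivity, real by γ₅, `= 1` at `t = 0`) and
`det D_c = (μ+4)^{n_c} det(1 − K_c/(μ+4))` with `n_c` even. Consequence for the crux: at valence
masses `μ > 0` NO cell is a sign defect — clause (ii) is vacuous in the heavy junk corner. [folklore] -/
theorem det_compressed_re_pos (hρ : ∀ g, ρ g ∈ Matrix.unitaryGroup (Fin N) ℂ) (U : GaugeConfig 4 L G)
    (P : TorusSite 4 L → Prop) [DecidablePred P] {μ : ℝ} (hμ : 4 < |μ + 4|) :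
    0 < (((wilsonDirac ρ U μ 1).toSquareBlockProp fun q => P q.1).det).re := by
  have hμ4 : μ + 4 ≠ 0 := fun h => by rw [h, abs_zero] at hμ; linarith
  set p : TorusSite 4 L × Fin N × Fin 4 → Prop := fun q => P q.1 with hp
  set Kc := (∑ ν, wilsonHop ρ U ν).toSquareBlockProp p with hKc
  set g : ℝ → ℝ := fun t =>
    (((1 : Matrix {a // p a} {a // p a} ℂ) - ((t / (μ + 4) : ℝ) : ℂ) • Kc).det).re with hgdef
  have hcont : Continuous fun t : ℝ =>
      ((1 : Matrix {a // p a} {a // p a} ℂ) - ((t / (μ + 4) : ℝ) : ℂ) • Kc).det := by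
    have h : Continuous fun t : ℝ =>
        ((1 : Matrix {a // p a} {a // p a} ℂ) - ((t / (μ + 4) : ℝ) : ℂ) • Kc) := by
      refine continuous_const.sub ?_
      exact (Complex.continuous_ofReal.comp (continuous_id.div_const (μ + 4))).smul
        continuous_const
    exact h.matrix_det
  have hg : Continuous g := Complex.continuous_re.comp hcont
  have hg0 : g 0 = 1 := by simp [hgdef]
  have hne : ∀ t ∈ Set.Icc (0 : ℝ) 1, g t ≠ 0 := by
    intro t ht h0
    apply det_cellSeg_ne_zero ρ hρ U p hμ ht.1 ht.2
    exact Complex.ext (by simpa [hgdef] using h0) (by simpa using det_cellSeg_im ρ hρ U p hμ4)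
  have hg1 : 0 < g 1 := by
    refine lt_of_not_ge fun hle => ?_
    have hmem : (0 : ℝ) ∈ Set.Icc (g 1) (g 0) := ⟨hle, by rw [hg0]; norm_num⟩
    obtain ⟨t, ht, ht0⟩ := intermediate_value_Icc' zero_le_one hg.continuousOn hmem
    exact hne t ht ht0
  have hD : (wilsonDirac ρ U μ 1).toSquareBlockProp p =
      ((μ + 4 : ℝ) : ℂ) • ((1 : Matrix {a // p a} {a // p a} ℂ) - ((1 / (μ + 4) : ℝ) : ℂ) • Kc) := by
    rw [smul_sub, smul_smul, ← Complex.ofReal_mul,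
      show (μ + 4) * (1 / (μ + 4)) = 1 by field_simp, Complex.ofReal_one, one_smul,
      wilsonDirac_eq_sub_sum_wilsonHop ρ hρ, toSquareBlockProp_smul_one_sub]
  have hdet : ((wilsonDirac ρ U μ 1).toSquareBlockProp p).det =
      (((μ + 4) ^ Fintype.card {a // p a} * g 1 : ℝ) : ℂ) := by
    rw [hD, det_smul]
    have him := det_cellSeg_im ρ hρ U p (t := 1) hμ4
    set d := ((1 : Matrix {a // p a} {a // p a} ℂ) - ((1 / (μ + 4) : ℝ) : ℂ) • Kc).det with hd
    have hd' : d = ((d.re : ℝ) : ℂ) := Complex.ext (by simp) (by simpa using him)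
    rw [hd', ← Complex.ofReal_pow, ← Complex.ofReal_mul]
  rw [hdet, Complex.ofReal_re]
  exact mul_pos ((even_card_sitePred P).pow_pos hμ4) hg1

end DetPos

/-! ### B.5 consequences for the crux vocabulary -/

/-- **The separator event sits inside the cell near-kernel event** — so clause (i) of `CoerciveSea`
follows from a Wegner-type law for the CELL operator `D_c`: a `τ`-singular separator yields a
non-zero `w` on the box with `‖D_c w‖² < τ² ‖w‖²` (i.e. `σ_min(D_c) < |τ|`), because for a vector
harmonic on the children interiors the full residual IS the separator residual. [folklore] -/
theorem hasSingularSeparator_cell_residual_lt {Nt : ℕ} [NeZero Nt]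
    {U : GaugeConfig 4 Nt (Matrix.specialUnitaryGroup (Fin 3) ℂ)} {μ τ : ℝ} {s : Fin 4 → ℕ}
    (h : HasSingularSeparator U μ s τ) :
    ∃ w : {p // wilsonBox (0 : TorusSite 4 Nt) s p} → ℂ, w ≠ 0 ∧
      ∑ p, ‖(wilsonCell U μ 0 s *ᵥ w) p‖ ^ 2 < τ ^ 2 * ∑ p, ‖w p‖ ^ 2 := by
  obtain ⟨w, ⟨p₀, -, hw₀⟩, hharm, hres⟩ := h
  refine ⟨w, fun h0 => hw₀ (by rw [h0]; rfl), ?_⟩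
  have hRfull : ∑ p, ‖(wilsonCell U μ 0 s *ᵥ w) p‖ ^ 2 =
      ∑ p, (if childrenInterior s p then 0 else ‖(wilsonCell U μ 0 s *ᵥ w) p‖ ^ 2) :=
    Finset.sum_congr rfl fun p _ => by
      split_ifs with hp
      · rw [hharm p hp]; simp
      · rfl
  have hsep_le : ∑ p, (if childrenInterior s p then 0 else ‖w p‖ ^ 2) ≤ ∑ p, ‖w p‖ ^ 2 :=
    Finset.sum_le_sum fun p _ => by
      split_ifs
      · positivity
      · exact le_rfl
  rw [hRfull]
  exact hres.trans_le (mul_le_mul_of_nonneg_left hsep_le (sq_nonneg τ))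

/-- `Re det` of every Dirichlet cell is positive off the hopping band. [folklore] -/
theorem cellDetRe_pos {Nt : ℕ} [NeZero Nt] (U : GaugeConfig 4 Nt (Matrix.specialUnitaryGroup (Fin 3) ℂ)) {μ : ℝ} (hμ : 4 < |μ + 4|)
    (x : TorusSite 4 Nt) (s : Fin 4 → ℕ) : 0 < cellDetRe U μ x s :=
  det_compressed_re_pos (fundamentalRep (Fin 3)) fundamentalRep_mem_unitaryGroup U (siteBox x s) hμ

/-- **No sign defects off the hopping band**: at bare masses with `|μ+4| > 4` (in particular all
`μ > 0`) no box at any scale is a sign defect, for ANY gauge field. [folklore] -/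
theorem not_isSignDefect {Nt : ℕ} [NeZero Nt] (U : GaugeConfig 4 Nt (Matrix.specialUnitaryGroup (Fin 3) ℂ)) {μ : ℝ} (hμ : 4 < |μ + 4|)
    (j : ℕ) (s : Fin 4 → ℕ) : ¬ IsSignDefect U μ j s := by
  have hprod : 0 < cellDetRe U μ 0 s * ∏ ε : Fin 4 → Bool, cellDetRe U μ (halfCorner s ε) (halfSides s ε) :=
    mul_pos (cellDetRe_pos U hμ 0 s) (Finset.prod_pos fun ε _ => cellDetRe_pos U hμ _ _)
  rintro (⟨-, h⟩ | ⟨-, h⟩)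
  · exact absurd h (not_lt.mpr (cellDetRe_pos U hμ 0 s).le)
  · exact absurd h (not_lt.mpr hprod.le)

/-- The Dirichlet determinant of every cell is real (route item `DirichletDetReal` in substance,
here for boxes). [folklore] -/
theorem det_wilsonCell_im {Nt : ℕ} [NeZero Nt] (U : GaugeConfig 4 Nt (Matrix.specialUnitaryGroup (Fin 3) ℂ)) (μ : ℝ) (x : TorusSite 4 Nt)
    (s : Fin 4 → ℕ) : (wilsonCell U μ x s).det.im = 0 :=
  det_compressed_im (fundamentalRep (Fin 3)) fundamentalRep_mem_unitaryGroup U μ (wilsonBox x s)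




/-! Parts A.2, A.3, C use classical decidability, as the route file does. -/
open scoped Classical

/-! ## Part A.2 — the pin clause forces the pin masses into the OPEN interval `(-8, 0)` -/

section Closure

variable {L N : ℕ} [NeZero L] {G : Type*} [Group G] (ρ : G →* Matrix (Fin N) (Fin N) ℂ)

/-- The Wilson determinant is continuous in the bare mass (a polynomial). [folklore] -/
theorem continuous_fermionDet_wilsonDirac_mass (hρ : ∀ g, ρ g ∈ Matrix.unitaryGroup (Fin N) ℂ)
    (U : GaugeConfig 4 L G) : Continuous fun m : ℝ => fermionDet (wilsonDirac ρ U m 1) := by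
  have h : Continuous fun m : ℝ =>
      ((m + 4 : ℝ) : ℂ) • (1 : Matrix (TorusSite 4 L × Fin N × Fin 4) _ ℂ) - ∑ μ, wilsonHop ρ U μ :=
    ((Complex.continuous_ofReal.comp (continuous_id.add continuous_const)).smul
      continuous_const).sub continuous_const
  simp_rw [fermionDet, wilsonDirac_eq_sub_sum_wilsonHop ρ hρ]
  exact h.matrix_det

/-- **Closure of Seiler positivity**: `Re det D_W(U, m, 1) ≥ 0` for `m ≥ 0` and for `m ≤ −8`
(limits of the open positivity ranges `m > 0`, `m < −8`). So the pin event `Re det < 0` is EMPTY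
at every bare mass outside the open interval `(−8, 0)`. [folklore] -/
theorem fermionDet_wilsonDirac_re_nonneg (hρ : ∀ g, ρ g ∈ Matrix.unitaryGroup (Fin N) ℂ)
    (U : GaugeConfig 4 L G) {m : ℝ} (hm : 0 ≤ m ∨ m ≤ -8) :
    0 ≤ (fermionDet (wilsonDirac ρ U m 1)).re := by
  set f : ℝ → ℝ := fun x => (fermionDet (wilsonDirac ρ U x 1)).re with hf
  have hcont : Continuous f :=
    Complex.continuous_re.comp (continuous_fermionDet_wilsonDirac_mass ρ hρ U)
  rcases hm with hm | hm
  · rcases hm.lt_or_eq with hlt | heq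
    · exact (fermionDet_wilsonDirac_re_pos_of_pos_or_lt ρ hρ U (Or.inl hlt)).le
    · subst heq
      have ht : Filter.Tendsto f (nhdsWithin 0 (Set.Ioi 0)) (nhds (f 0)) :=
        (hcont.tendsto 0).mono_left nhdsWithin_le_nhds
      have hev : ∀ᶠ x in nhdsWithin (0 : ℝ) (Set.Ioi 0), (0 : ℝ) ≤ f x :=
        eventually_nhdsWithin_of_forall fun x hx =>
          (fermionDet_wilsonDirac_re_pos_of_pos_or_lt ρ hρ U (Or.inl hx)).le
      exact ge_of_tendsto ht hev
  · rcases hm.lt_or_eq with hlt | heq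
    · exact (fermionDet_wilsonDirac_re_pos_of_pos_or_lt ρ hρ U (Or.inr hlt)).le
    · subst heq
      have ht : Filter.Tendsto f (nhdsWithin (-8) (Set.Iio (-8))) (nhds (f (-8))) :=
        (hcont.tendsto (-8)).mono_left nhdsWithin_le_nhds
      have hev : ∀ᶠ x in nhdsWithin (-8 : ℝ) (Set.Iio (-8)), (0 : ℝ) ≤ f x :=
        eventually_nhdsWithin_of_forall fun x hx =>
          (fermionDet_wilsonDirac_re_pos_of_pos_or_lt ρ hρ U (Or.inr hx)).le
      exact ge_of_tendsto ht hev

end Closure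


/-- **The pin clause (iii) of `CoerciveSea`, VERBATIM** (for `Nf`, a regularisation `reg`, the
threshold `M₀`, the mass tuple `m` entering the phase-quenched weight, and the physical size `R`):
for every `M > M₀`, eventually in `k`, on every odd torus of physical side `≥ R`, the phase-quenched
probability that `Re det D_W(U, mcrit k − a_k M / Z_m k, 1) < 0` is at least `1/4`. -/
def PinClause (Nf : ℕ) (reg : QCDRegularisation Nf) (M₀ : ℝ) (m : Fin Nf → ℝ) (R : ℝ) : Prop :=
  ∀ M : ℝ, M₀ < M → ∀ᶠ k : ℕ in Filter.atTop, ∀ S : ℕ, R ≤ reg.a k * (2 * S + 1) →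
    let N : ℕ := 2 * S + 1
    let mq : Fin Nf → ℝ := fun f => reg.mcrit k + reg.a k * m f / reg.Zm k
    let wt : GaugeConfig 4 N (Matrix.specialUnitaryGroup (Fin 3) ℂ) → ℝ := fun U =>
      ∏ f, ‖fermionDet (wilsonDirac (fundamentalRep (Fin 3)) U (mq f) 1)‖
    (1 / 4 : ℝ) ≤
      (∫ U, (if (fermionDet (wilsonDirac (fundamentalRep (Fin 3)) U
              (reg.mcrit k - reg.a k * M / reg.Zm k) 1)).re < 0 then (1 : ℝ) else 0) * wt U
          ∂(wilsonMeasure (d := 4) (L := N) (fundamentalRep (Fin 3)) (reg.β k))) /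
        (∫ U, wt U ∂(wilsonMeasure (d := 4) (L := N) (fundamentalRep (Fin 3)) (reg.β k)))

/-- **`CoerciveSea` at a given regularisation**: the body of the crux after `∃ reg`, VERBATIM. -/
def CoerciveSeaAt (Nf : ℕ) (reg : QCDRegularisation Nf) : Prop :=
  reg.HasMassScaling ∧ (reg.scheme 0 0 0).HasAsymptoticScaling ∧ ∃ M₀ : ℝ, 0 ≤ M₀ ∧ ∃ b₀ : ℕ, 2 ≤ b₀ ∧ ∃ ℓ : ℝ, 0 < ℓ ∧ ∀ m : Fin Nf → ℝ, (∀ f, M₀ < m f) → ∃ R : ℝ, 0 < R ∧ (∃ C : ℝ, 0 < C ∧ ∃ α : ℝ, 0 < α ∧ ∀ᶠ k : ℕ in Filter.atTop, ∀ S : ℕ, R ≤ reg.a k * (2 * S + 1) → let N : ℕ := 2 * S + 1; let mq : Fin Nf → ℝ := fun f => reg.mcrit k + reg.a k * m f / reg.Zm k; let wt : GaugeConfig 4 N (Matrix.specialUnitaryGroup (Fin 3) ℂ) → ℝ := fun U => ∏ f, ‖fermionDet (wilsonDirac (fundamentalRep (Fin 3)) U (mq f) 1)‖; let P : (GaugeConfig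 4 N (Matrix.specialUnitaryGroup (Fin 3) ℂ) → Prop) → ℝ := fun E => (∫ U, (if E U then (1 : ℝ) else 0) * wt U ∂(wilsonMeasure (d := 4) (L := N) (fundamentalRep (Fin 3)) (reg.β k))) / (∫ U, wt U ∂(wilsonMeasure (d := 4) (L := N) (fundamentalRep (Fin 3)) (reg.β k))); ∀ s : Fin 4 → ℕ, (∀ i, b₀ ≤ s i ∧ s i ≤ N ∧ (s i : ℝ) * reg.a k ≤ ℓ) → (∀ i j, s i ≤ 2 * s j) → ∀ f : Fin Nf, ∀ t : ℝ, 0 < t → t ≤ 1 → P (fun U => HasSingularSeparator U (mq f) s (t / s 0)) ≤ C * t ^ α) ∧ (∀ ε : ℝ, 0 < ε → ∀ᶠ k : ℕ in Filter.atTop, ∀ S : ℕ, R ≤ reg.a k * (2 * S + 1) → let N : ℕ := 2 * S + 1; let mq : Fin Nf → ℝ := fun f => reg.mcrit k + reg.a k * m f / reg.Zm k; let wt : GaugeConfig 4 N (Matrix.specialUnitaryGroup (Fin 3) ℂ) → ℝ := fun U => ∏ f, ‖fermionDet (wilsonDirac (fundamentalRep (Fin 3)) U (mq f) 1)‖; let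 P : (GaugeConfig 4 N (Matrix.specialUnitaryGroup (Fin 3) ℂ) → Prop) → ℝ := fun E => (∫ U, (if E U then (1 : ℝ) else 0) * wt U ∂(wilsonMeasure (d := 4) (L := N) (fundamentalRep (Fin 3)) (reg.β k))) / (∫ U, wt U ∂(wilsonMeasure (d := 4) (L := N) (fundamentalRep (Fin 3)) (reg.β k))); let J : ℕ := Nat.log 2 (⌊ℓ / reg.a k⌋₊ / b₀) + 1; ∃ δ : ℕ → ℝ, ∑ j ∈ Finset.range J, δ j ≤ ε ∧ ∀ j < J, ∀ s : Fin 4 → ℕ, (∀ i, b₀ * 2 ^ j ≤ s i ∧ s i < b₀ * 2 ^ (j + 2) ∧ s i ≤ N ∧ (s i : ℝ) * reg.a k ≤ ℓ) → P (fun U => ∃ f, IsSignDefect U (mq f) j s) ≤ δ j) ∧ PinClause Nf reg M₀ m R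

/-- The crux is `∀ Nf ∈ {2,3}, ∃ reg, CoerciveSeaAt Nf reg` (definitional unfolding). -/
theorem coerciveSea_iff :
    Summit.QuantumFields.QCD.Theses.NestedDissectionSea.CoerciveSea ↔
      ∀ Nf : ℕ, (Nf = 2 ∨ Nf = 3) → ∃ reg : QCDRegularisation Nf, CoerciveSeaAt Nf reg :=
  Iff.rfl

/-- Every positive real is below `a_k (2S+1)` for some `S` (the torus sizes are unbounded).
[folklore] -/
theorem exists_torus_ge {Nf : ℕ} (reg : QCDRegularisation Nf) (k : ℕ) (R : ℝ) :
    ∃ S : ℕ, R ≤ reg.a k * (2 * S + 1) := by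
  obtain ⟨n, hn⟩ := exists_nat_ge (R / reg.a k)
  have ha := reg.a_pos k
  have hn' : R ≤ (n : ℝ) * reg.a k := by rwa [div_le_iff₀ ha] at hn
  have hn0 : (0 : ℝ) ≤ (n : ℝ) * reg.a k := mul_nonneg (Nat.cast_nonneg n) ha.le
  exact ⟨n, by nlinarith⟩

/-- **The pin window.** If the pin clause holds for `(reg, M₀, m, R)` then for every `M > M₀`,
eventually in `k`, the pin mass `μ₀ = mcrit k − a_k M / Z_m k` lies in the OPEN interval `(−8, 0)`:
outside it `Re det D_W(U, μ₀, 1) ≥ 0` for EVERY gauge field (`fermionDet_wilsonDirac_re_nonneg`),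
the pin event is empty, the phase-quenched ratio is `0 < 1/4`. Any proof of the crux must
therefore place `mcrit` within `a_k M₀/Z_m k` of `(−8, 0]`; the junk corners `mcrit ≫ 0` (where
(i),(ii) are vacuous, Part C) and `mcrit ≤ −8` are dead. [folklore] -/
theorem PinClause.mass_mem_Ioo {Nf : ℕ} {reg : QCDRegularisation Nf} {M₀ : ℝ} {m : Fin Nf → ℝ}
    {R : ℝ} (h : PinClause Nf reg M₀ m R) {M : ℝ} (hM : M₀ < M) :
    ∀ᶠ k : ℕ in Filter.atTop, reg.mcrit k - reg.a k * M / reg.Zm k ∈ Set.Ioo (-8 : ℝ) 0 := by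
  filter_upwards [h M hM] with k hk
  obtain ⟨S, hS⟩ := exists_torus_ge reg k R
  have hkS := hk S hS
  by_contra hout
  have hμ : 0 ≤ reg.mcrit k - reg.a k * M / reg.Zm k ∨ reg.mcrit k - reg.a k * M / reg.Zm k ≤ -8 := by
    simp only [Set.mem_Ioo, not_and_or, not_lt] at hout
    rcases hout with h1 | h1
    · exact Or.inr h1
    · exact Or.inl h1
  have hzero : ∀ U : GaugeConfig 4 (2 * S + 1) (Matrix.specialUnitaryGroup (Fin 3) ℂ),
      ¬ (fermionDet (wilsonDirac (fundamentalRep (Fin 3)) U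
          (reg.mcrit k - reg.a k * M / reg.Zm k) 1)).re < 0 := fun U =>
    not_lt.mpr (fermionDet_wilsonDirac_re_nonneg _ (fundamentalRep_mem_unitaryGroup) U hμ)
  simp only [hzero, if_false, zero_mul, integral_zero, zero_div] at hkS
  norm_num at hkS

/-- Projection of the crux onto its pin clause (clauses (i),(ii) dropped). -/
theorem CoerciveSeaAt.pin {Nf : ℕ} {reg : QCDRegularisation Nf} (h : CoerciveSeaAt Nf reg) :
    ∃ M₀ : ℝ, 0 ≤ M₀ ∧ ∀ m : Fin Nf → ℝ, (∀ f, M₀ < m f) → ∃ R : ℝ, 0 < R ∧ PinClause Nf reg M₀ m R := by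
  obtain ⟨-, -, M₀, hM₀, b₀, -, ℓ, -, hm⟩ := h
  refine ⟨M₀, hM₀, fun m hmm => ?_⟩
  obtain ⟨R, hR, -, -, hpin⟩ := hm m hmm
  exact ⟨R, hR, hpin⟩

/-- **Necessary condition on any witness of the crux**: its pin masses sit in `(−8, 0)`
eventually, for every `M` above its threshold. -/
theorem CoerciveSeaAt.mass_mem_Ioo {Nf : ℕ} {reg : QCDRegularisation Nf} (h : CoerciveSeaAt Nf reg) :
    ∃ M₀ : ℝ, 0 ≤ M₀ ∧ ∀ M : ℝ, M₀ < M →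
      ∀ᶠ k : ℕ in Filter.atTop, reg.mcrit k - reg.a k * M / reg.Zm k ∈ Set.Ioo (-8 : ℝ) 0 := by
  obtain ⟨M₀, hM₀, hm⟩ := h.pin
  refine ⟨M₀, hM₀, fun M hM => ?_⟩
  haveI : Nonempty (Fin Nf → ℝ) := ⟨fun _ => M₀ + 1⟩
  obtain ⟨R, -, hpin⟩ := hm (fun _ => M₀ + 1) (fun _ => by linarith)
  exact hpin.mass_mem_Ioo hM

/-- The same read on the crux itself. -/
theorem coerciveSea_pin_mass_mem_Ioo
    (h : Summit.QuantumFields.QCD.Theses.NestedDissectionSea.CoerciveSea) (Nf : ℕ)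
    (hNf : Nf = 2 ∨ Nf = 3) :
    ∃ reg : QCDRegularisation Nf, reg.HasMassScaling ∧ ∃ M₀ : ℝ, 0 ≤ M₀ ∧ ∀ M : ℝ, M₀ < M →
      ∀ᶠ k : ℕ in Filter.atTop, reg.mcrit k - reg.a k * M / reg.Zm k ∈ Set.Ioo (-8 : ℝ) 0 := by
  obtain ⟨reg, hreg⟩ := coerciveSea_iff.mp h Nf hNf
  exact ⟨reg, hreg.1, hreg.mass_mem_Ioo⟩

/-! ## Part A.3 — junk regularisations excluded by the pin -/

/-- A regularisation whose critical mass dips to `−8` or below infinitely often is not a witness.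
[folklore] -/
theorem not_coerciveSeaAt_of_frequently_le_neg_eight {Nf : ℕ} {reg : QCDRegularisation Nf}
    (h8 : ∃ᶠ k : ℕ in Filter.atTop, reg.mcrit k ≤ -8) : ¬ CoerciveSeaAt Nf reg := by
  intro h
  obtain ⟨M₀, hM₀, hM⟩ := h.mass_mem_Ioo
  have hev := hM (M₀ + 1) (by linarith)
  refine (h8.and_eventually hev).exists.elim fun k hk => ?_
  obtain ⟨hlt, hmem⟩ := hk
  have hpos : 0 ≤ reg.a k * (M₀ + 1) / reg.Zm k :=
    div_nonneg (mul_nonneg (reg.a_pos k).le (by linarith)) (reg.Zm_pos k).le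
  have := hmem.1
  linarith

/-- `HasMassScaling` (with a positive leading-log exponent, i.e. `N_f ≤ 16`) and `a_k → 0` force
`a_k / Z_m k → 0`: `Z_m k ≥ (c/2)·(log a_k⁻²)^e ≥ c/2` eventually. [folklore] -/
theorem tendsto_a_div_Zm {Nf : ℕ} (reg : QCDRegularisation Nf) (hms : reg.HasMassScaling)
    (he : 0 < massExponent Nf) :
    Filter.Tendsto (fun k => reg.a k / reg.Zm k) Filter.atTop (nhds 0) := by
  obtain ⟨c, hc, hlim⟩ := hms
  -- eventually a_k < exp(-1/2), so log(1/a_k²) > 1 and its positive power exceeds 1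
  have ha0 := reg.tendsto_a
  have hsmall : ∀ᶠ k in Filter.atTop, reg.a k < Real.exp (-1) := by
    exact ha0.eventually (gt_mem_nhds (Real.exp_pos _))
  have hratio : ∀ᶠ k in Filter.atTop, c / 2 < reg.Zm k / Real.log (1 / reg.a k ^ 2) ^ massExponent Nf :=
    hlim.eventually (lt_mem_nhds (by linarith))
  have hZ : ∀ᶠ k in Filter.atTop, c / 2 ≤ reg.Zm k := by
    filter_upwards [hsmall, hratio] with k hk hr
    have ha := reg.a_pos k
    have hlog : 1 ≤ Real.log (1 / reg.a k ^ 2) := by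
      rw [Real.le_log_iff_exp_le (by positivity)]
      have h1 : reg.a k ^ 2 < Real.exp (-1) ^ 2 := by gcongr
      have h2 : Real.exp (-1) ^ 2 = (Real.exp 1)⁻¹ ^ 2 := by rw [Real.exp_neg]
      rw [one_div, le_inv_comm₀ (Real.exp_pos 1) (by positivity)]
      calc reg.a k ^ 2 ≤ Real.exp (-1) ^ 2 := h1.le
        _ = Real.exp (-2) := by rw [← Real.exp_nat_mul]; norm_num
        _ ≤ (Real.exp 1)⁻¹ := by
            rw [← Real.exp_neg]; exact Real.exp_le_exp.mpr (by norm_num)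
    have hpow : 1 ≤ Real.log (1 / reg.a k ^ 2) ^ massExponent Nf :=
      Real.one_le_rpow hlog he.le
    have hpos : 0 < Real.log (1 / reg.a k ^ 2) ^ massExponent Nf := by linarith
    rw [lt_div_iff₀ hpos] at hr
    nlinarith
  -- squeeze 0 ≤ a/Z ≤ (2/c) a → 0
  have hupper : Filter.Tendsto (fun k => 2 / c * reg.a k) Filter.atTop (nhds 0) := by
    simpa using ha0.const_mul (2 / c)
  refine tendsto_of_tendsto_of_tendsto_of_le_of_le' tendsto_const_nhds hupper ?_ ?_
  · filter_upwards with k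
    exact div_nonneg (reg.a_pos k).le (reg.Zm_pos k).le
  · filter_upwards [hZ] with k hk
    have ha := reg.a_pos k
    have hZp := reg.Zm_pos k
    rw [div_le_iff₀ hZp]
    calc reg.a k = 2 / c * reg.a k * (c / 2) := by field_simp
      _ ≤ 2 / c * reg.a k * reg.Zm k := by gcongr

/-- The leading-log exponent is positive for `N_f = 2, 3` (indeed for `N_f ≤ 16`). [folklore] -/
theorem massExponent_pos {Nf : ℕ} (hNf : Nf ≤ 16) : 0 < massExponent Nf := by
  have hπ : 0 < Real.pi ^ 2 := by positivity
  have hN : (Nf : ℝ) ≤ 16 := by exact_mod_cast hNf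
  unfold massExponent gammaCoeff₀ betaCoeff₀
  apply div_pos (by positivity)
  apply mul_pos two_pos
  apply div_pos _ (by positivity)
  linarith

/-- **The heavy junk corner is dead.** A regularisation whose critical mass stays above a
positive constant infinitely often — the regime where clauses (i) and (ii) hold VACUOUSLY
(Part C) — cannot witness the crux for `N_f ≤ 16`: `a_k M / Z_m k → 0` by `HasMassScaling`, so
the pin mass is eventually positive there, contradicting `PinClause.mass_mem_Ioo`. -/
theorem not_coerciveSeaAt_of_frequently_ge {Nf : ℕ} (hNf : Nf ≤ 16) {reg : QCDRegularisation Nf}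
    {c : ℝ} (hc : 0 < c) (hge : ∃ᶠ k : ℕ in Filter.atTop, c ≤ reg.mcrit k) :
    ¬ CoerciveSeaAt Nf reg := by
  intro h
  have hms : reg.HasMassScaling := h.1
  obtain ⟨M₀, hM₀, hM⟩ := h.mass_mem_Ioo
  have hev := hM (M₀ + 1) (by linarith)
  have haz := tendsto_a_div_Zm reg hms (massExponent_pos hNf)
  have hsmall : ∀ᶠ k in Filter.atTop, reg.a k / reg.Zm k < c / (M₀ + 1) :=
    haz.eventually (gt_mem_nhds (by positivity))
  refine (hge.and_eventually (hev.and hsmall)).exists.elim fun k hk => ?_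
  obtain ⟨hck, hmem, hs⟩ := hk
  have hM1 : (0 : ℝ) < M₀ + 1 := by linarith
  have h1 : reg.a k * (M₀ + 1) / reg.Zm k < c := by
    rw [mul_comm, mul_div_assoc]
    calc (M₀ + 1) * (reg.a k / reg.Zm k) < (M₀ + 1) * (c / (M₀ + 1)) := by gcongr
      _ = c := by field_simp
  have := hmem.2
  linarith

/-- The concrete heavy junk regularisation: `canonicalAF` (the tree's non-vacuity witness of both
scalings) with its critical mass parked at `+1`. Clauses (i),(ii) hold vacuously for it (Part C),
yet it is NOT a witness of `CoerciveSea` for `N_f ≤ 16`. -/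
def heavyJunkReg (Nf : ℕ) : QCDRegularisation Nf :=
  { QCDRegularisation.canonicalAF Nf with mcrit := fun _ => 1 }

/-- The heavy junk regularisation is not a witness of the crux (`N_f ≤ 16`). [folklore] -/
theorem not_coerciveSeaAt_heavyJunkReg {Nf : ℕ} (hNf : Nf ≤ 16) :
    ¬ CoerciveSeaAt Nf (heavyJunkReg Nf) :=
  not_coerciveSeaAt_of_frequently_ge hNf one_pos
    (Filter.Eventually.frequently (Filter.Eventually.of_forall fun _ => le_rfl))

/-! ## Part C — without the pin the crux is TRIVIAL (junk witness `mcrit ≡ 1`) -/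

/-- **`CoerciveSea` with the pin clause (iii) deleted**, at a given regularisation: clauses (i)
(separator Wegner law in the window) and (ii) (windowed local dilution) only, VERBATIM. -/
def CoerciveSeaWithoutPinAt (Nf : ℕ) (reg : QCDRegularisation Nf) : Prop :=
  reg.HasMassScaling ∧ (reg.scheme 0 0 0).HasAsymptoticScaling ∧ ∃ M₀ : ℝ, 0 ≤ M₀ ∧ ∃ b₀ : ℕ, 2 ≤ b₀ ∧ ∃ ℓ : ℝ, 0 < ℓ ∧ ∀ m : Fin Nf → ℝ, (∀ f, M₀ < m f) → ∃ R : ℝ, 0 < R ∧ (∃ C : ℝ, 0 < C ∧ ∃ α : ℝ, 0 < α ∧ ∀ᶠ k : ℕ in Filter.atTop, ∀ S : ℕ, R ≤ reg.a k * (2 * S + 1) → let N : ℕ := 2 * S + 1; let mq : Fin Nf → ℝ := fun f => reg.mcrit k + reg.a k * m f / reg.Zm k; let wt : GaugeConfig 4 N (Matrix.specialUnitaryGroup (Fin 3) ℂ) → ℝ := fun U => ∏ f, ‖fermionDet (wilsonDirac (fundamentalRep (Fin 3)) U (mq f) 1)‖; let P : (GaugeConfig 4 N (Matrix.specialUnitaryGroup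 (Fin 3) ℂ) → Prop) → ℝ := fun E => (∫ U, (if E U then (1 : ℝ) else 0) * wt U ∂(wilsonMeasure (d := 4) (L := N) (fundamentalRep (Fin 3)) (reg.β k))) / (∫ U, wt U ∂(wilsonMeasure (d := 4) (L := N) (fundamentalRep (Fin 3)) (reg.β k))); ∀ s : Fin 4 → ℕ, (∀ i, b₀ ≤ s i ∧ s i ≤ N ∧ (s i : ℝ) * reg.a k ≤ ℓ) → (∀ i j, s i ≤ 2 * s j) → ∀ f : Fin Nf, ∀ t : ℝ, 0 < t → t ≤ 1 → P (fun U => HasSingularSeparator U (mq f) s (t / s 0)) ≤ C * t ^ α) ∧ (∀ ε : ℝ, 0 < ε → ∀ᶠ k : ℕ in Filter.atTop, ∀ S : ℕ, R ≤ reg.a k * (2 * S + 1) → let N : ℕ := 2 * S + 1; let mq : Fin Nf → ℝ := fun f => reg.mcrit k + reg.a k * m f / reg.Zm k; let wt : GaugeConfig 4 N (Matrix.specialUnitaryGroup (Fin 3) ℂ) → ℝ := fun U => ∏ f, ‖fermionDet (wilsonDirac (fundamentalRep (Fin 3)) U (mq f) 1)‖; let P : (GaugeConfig 4 N (Matrix.specialUnitaryGroup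 (Fin 3) ℂ) → Prop) → ℝ := fun E => (∫ U, (if E U then (1 : ℝ) else 0) * wt U ∂(wilsonMeasure (d := 4) (L := N) (fundamentalRep (Fin 3)) (reg.β k))) / (∫ U, wt U ∂(wilsonMeasure (d := 4) (L := N) (fundamentalRep (Fin 3)) (reg.β k))); let J : ℕ := Nat.log 2 (⌊ℓ / reg.a k⌋₊ / b₀) + 1; ∃ δ : ℕ → ℝ, ∑ j ∈ Finset.range J, δ j ≤ ε ∧ ∀ j < J, ∀ s : Fin 4 → ℕ, (∀ i, b₀ * 2 ^ j ≤ s i ∧ s i < b₀ * 2 ^ (j + 2) ∧ s i ≤ N ∧ (s i : ℝ) * reg.a k ≤ ℓ) → P (fun U => ∃ f, IsSignDefect U (mq f) j s) ≤ δ j)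

/-- `CoerciveSea` with the pin deleted (same `∀ Nf ∈ {2,3} ∃ reg` prefix). -/
def CoerciveSeaWithoutPin : Prop :=
  ∀ Nf : ℕ, (Nf = 2 ∨ Nf = 3) → ∃ reg : QCDRegularisation Nf, CoerciveSeaWithoutPinAt Nf reg

/-- The crux at `reg` is exactly "(i) ∧ (ii) at `reg`, with the pin appended under the same
`M₀, b₀, ℓ, m, R`" — recorded as the one-directional projection that is definitionally free. -/
theorem CoerciveSeaAt.withoutPin {Nf : ℕ} {reg : QCDRegularisation Nf} (h : CoerciveSeaAt Nf reg) :
    CoerciveSeaWithoutPinAt Nf reg := by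
  obtain ⟨h1, h2, M₀, hM₀, b₀, hb₀, ℓ, hℓ, hm⟩ := h
  refine ⟨h1, h2, M₀, hM₀, b₀, hb₀, ℓ, hℓ, fun m hmm => ?_⟩
  obtain ⟨R, hR, hi, hii, -⟩ := hm m hmm
  exact ⟨R, hR, hi, hii⟩

/-- The bare valence masses of the heavy junk regularisation are `≥ 1`. [folklore] -/
theorem heavyJunkReg_mq_ge_one (Nf : ℕ) {m : Fin Nf → ℝ} {M₀ : ℝ} (hM₀ : 0 ≤ M₀)
    (hm : ∀ f, M₀ < m f) (k : ℕ) (f : Fin Nf) :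
    (1 : ℝ) ≤ (heavyJunkReg Nf).mcrit k + (heavyJunkReg Nf).a k * m f / (heavyJunkReg Nf).Zm k := by
  have ha := (heavyJunkReg Nf).a_pos k
  have hZ := (heavyJunkReg Nf).Zm_pos k
  have hmf : 0 < m f := hM₀.trans_lt (hm f)
  have h0 : 0 ≤ (heavyJunkReg Nf).a k * m f / (heavyJunkReg Nf).Zm k := by positivity
  change (1 : ℝ) ≤ 1 + _
  linarith

/-- **WITHOUT THE PIN THE HINGE IS TRIVIAL.** The heavy junk regularisation (`canonicalAF` with
`mcrit ≡ 1`, both scalings inherited) satisfies clauses (i) and (ii) of `CoerciveSea` for EVERY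
`N_f`, with `M₀ = 0`, `b₀ = 2`, `ℓ = R = C = α = 1`, `δ ≡ 0`: at its valence masses
`m_f(k) = 1 + a_k m_f/Z_m k ≥ 1` the separator event is empty (`hasSingularSeparator_mass_lt`:
it needs `m_f(k) < t/s₀ ≤ 1/2`) and no cell is a sign defect (`not_isSignDefect`: all Dirichlet
determinants are positive), so every phase-quenched probability in (i),(ii) is `0`. Together with
`not_coerciveSeaAt_heavyJunkReg` (Part A.3): the pin (iii) is the ONLY clause standing between the
hinge and a junk proof — all of its content is "where is `mcrit`". -/
theorem coerciveSeaWithoutPinAt_heavyJunkReg (Nf : ℕ) : CoerciveSeaWithoutPinAt Nf (heavyJunkReg Nf) := by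
  refine ⟨QCDRegularisation.canonicalAF_hasMassScaling, ?_, 0, le_rfl, 2, le_rfl, 1, one_pos,
    fun m hm => ⟨1, one_pos, ?_, ?_⟩⟩
  · exact ⟨1, one_pos, by
      simp [heavyJunkReg, QCDRegularisation.scheme, QCDRegularisation.canonicalAF, QCDScheme.zeroAF]⟩
  · -- clause (i): the separator event is empty at valence masses ≥ 1
    refine ⟨1, one_pos, 1, one_pos, Filter.Eventually.of_forall fun k S _ => ?_⟩
    intro N mq wt P s hs _ f t ht0 ht1
    have hs0 : (2 : ℝ) ≤ (s 0 : ℝ) := by exact_mod_cast (hs 0).1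
    have hmq : (1 : ℝ) ≤ mq f := heavyJunkReg_mq_ge_one Nf le_rfl hm k f
    have hempty : ∀ U : GaugeConfig 4 N (Matrix.specialUnitaryGroup (Fin 3) ℂ),
        ¬ HasSingularSeparator U (mq f) s (t / s 0) := fun U hU => by
      have h1 := hasSingularSeparator_mass_lt hU
      have h2 : |t / (s 0 : ℝ)| ≤ 1 / 2 := by
        rw [abs_of_nonneg (by positivity), div_le_div_iff₀ (by positivity) two_pos]
        linarith
      linarith
    simp only [P, hempty, if_false, zero_mul, integral_zero, zero_div]
    positivity
  · -- clause (ii): no sign defects at valence masses ≥ 1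
    intro ε hε
    refine Filter.Eventually.of_forall fun k S _ => ?_
    intro N mq wt P J
    refine ⟨fun _ => 0, by simp [hε.le], fun j _ s _ => ?_⟩
    have hempty : ∀ U : GaugeConfig 4 N (Matrix.specialUnitaryGroup (Fin 3) ℂ),
        ¬ ∃ f, IsSignDefect U (mq f) j s := fun U ⟨f, hf⟩ => by
      have hmq : (1 : ℝ) ≤ mq f := heavyJunkReg_mq_ge_one Nf le_rfl hm k f
      have h4 : 4 < |mq f + 4| := by rw [abs_of_pos (by linarith)]; linarith
      exact not_isSignDefect U h4 j s hf
    simp only [P, hempty, if_false, zero_mul, integral_zero, zero_div, le_refl]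

/-- Hence the pin-less crux holds outright (for every `N_f`, a fortiori for `N_f ∈ {2,3}`). -/
theorem coerciveSeaWithoutPin_holds : CoerciveSeaWithoutPin :=
  fun Nf _ => ⟨heavyJunkReg Nf, coerciveSeaWithoutPinAt_heavyJunkReg Nf⟩

/-- … while the SAME regularisation is not a witness of the crux (`N_f ≤ 16`): the junk proof of
(i) ∧ (ii) and the pin are mutually exclusive. -/
theorem heavyJunk_dichotomy {Nf : ℕ} (hNf : Nf ≤ 16) :
    CoerciveSeaWithoutPinAt Nf (heavyJunkReg Nf) ∧ ¬ CoerciveSeaAt Nf (heavyJunkReg Nf) :=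
  ⟨coerciveSeaWithoutPinAt_heavyJunkReg Nf, not_coerciveSeaAt_heavyJunkReg hNf⟩




/-! ## Part D — quantitative margins, threats, near-misses (prose; nothing below is used above) -/

/-- **Physics margins of the three clauses (why no kill, and where one would come from).**

* Units of (i) are right: in the free corner (`U ≡ 1`, `μ → 0⁻`) the Dirichlet `r = 1` cell has
  `σ_min(D_c) ≍ c/s` with `c ∈ [π/2, 2π]` per direction (the chiral quarter-wave mode escapes the
  near wall: `D = 1 − P₋T − P₊T†` in 1D has `‖Dv‖/‖v‖ ≈ π/(2n)` on the ramp/quarter-wave), and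
  `σ_min(S_Σ)` in harmonic-extension form is `≥ σ_min(D_c)` (for harmonic `w`, `D_c w` lives on
  `Σ`); so for `t < c` the event of (i) is EMPTY near the free corner — a `1/s²` law would have
  made (i) false for mesoscopic near-free boxes, a `1/s` law does not.
* What (i) costs as `t → 0`: for fixed `(k, S, box)` the law `P(σ_min < τ) ≤ C' τ^{α'}` is
  automatic (Łojasiewicz for the real-analytic `U ↦ det D_c(μ_k)`; generically `α' = 1` where
  `{det S_Σ = 0}` is a transversal hypersurface), so the CONTENT is uniformity: with
  `P(σ_min(S_Σ) < τ) ≈ D(s,k)·τ`, `τ = t/s`, one needs `D(s,k) ≤ C s` for all window sides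
  `s ≤ ℓ/a_k`, i.e. a density of real Dirichlet-cell eigenvalues AT the valence line of at most
  `≈ C a_k³/ℓ³` per site per unit bare mass. The route's own carrier count (early crossers
  `∝ a_k^{(b+b'−4)/2}` per physical 4-volume, `b − 4 = 5, 17/3`) is `a_k^{≥ 6.5}` per site — margin
  `a_k^{3.5}`. The sharpest threat is NOT topological: Golterman–Shamir(–Svetitsky) localised
  near-zero modes of `γ₅ D_W(μ)` OUTSIDE the Aoki phase (mobility edge `> 0`, `ρ(0) > 0` at fixed
  `β`): if their density at the valence line were `≳ a_k³` per site per unit mass, the `s³` growth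
  of `D(s,k)` across the window would kill (i) (and, dropping the window `s a_k ≤ ℓ`, kills the
  un-windowed strengthening outright whenever `ρ(0) > 0`). Nothing rigorous is known either way.
* (ii) is an upper bound on local events; it fails only if early crossers (real cell eigenvalues
  crossing ABOVE the valence mass) are not window-dilute — Mohler–Schaefer's `2% → 0.05%` per
  `(3 fm)⁴` at the strange mass is consistent with dilution; no printed counterexample.
* (iii) forces `mcrit` onto `[−8,0] + a_k M₀/Z_m` (Part A) and, physically, onto the chiral line:
  shifting `mcrit` UP by a lattice-unit amount empties the pin (no real modes above the physical
  branch), shifting it into a doubler gap (`μ₀ ≈ −3`) satisfies the pin (parity of physical +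
  first-doubler real modes is random in large volume) but then (ii) fails for the same reason
  (cell signs at `μ = −3` are random parities, not dilute) — physics, not Lean.
* Refuter levers that remain: `S → ∞` at fixed `k` (all three clauses must hold in the
  thermodynamic limit of the phase-quenched measure at fixed cutoff — plausible: events are local,
  weights positive); `t → 0` (above); `M ↓ M₀` (pin just below the shifted line — fine in the
  continuum picture since crossing bands shrink like `a/ρ²`). None yields a contradiction without
  a quantitative spectral input that is itself open.
* Barrier catalogue: `WilsonDeterminantSign` (sign = parity of real modes below the mass) is what
  Part A exploits at `|μ+4| > 4`; `HoppingExpansion*` barriers are evaded by the statement (no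
  hopping series); `AokiPhase`-type obstructions bite only the physics of (ii)/(iii) near the line.
* Statement-design remarks (cosmetic, for the planner; none is a refutation): `reg.L` (the volumes
  of the regularisation) is IDLE data in this crux — every clause quantifies over all odd tori of
  physical side `≥ R` instead; `(reg.scheme 0 0 0).HasAsymptoticScaling` constrains only `β_k`,
  which enters solely through `wilsonMeasure … (reg.β k)` (no clause is sensitive to it at the
  level of rigour available — the junk analysis above never used it); in (ii) the `δ_j` are not
  required to be `≥ 0`, so on the SMALLEST admissible tori (`N < b₀2^j` for top window scales, i.e.
  when `R < ℓ`) empty scales can carry arbitrarily negative `δ_j` and trivialise `Σ δ_j ≤ ε` there —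
  harmless because (ii) must also hold on all larger tori where every scale `j < J` is populated
  (the parity-free `EarlyCrosserLaw` already carries `δ ≥ 0`); `t ≤ 1` in (i) is cosmetic
  (`C ≥ 1` absorbs `t ≥ 1`). The pin window `(−8, 0)` of Part A is not claimed sharp: physically
  the pin can only be met on the first branch `μ₀ ∈ (m_c(β) − O(a), m_c(β)]`, and parking `mcrit`
  in a doubler gap is killed by (ii), but neither refinement is provable without spectral input.
-/
theorem physicsMargins : True := trivial

/-! ## Part E (cycle 2) — THE PIN IS SELF-SUFFICIENT: it alone forces `a_k/Z_m k → 0`,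
`limsup mcrit ≤ 0`, `liminf mcrit ≥ −8` (no `HasMassScaling`, every `N_f`)

Landed form: `Summits/QuantumFields/QCD/Theorems/CoerciveSea/Negative/PinSelfSufficiency.lean`
(p83270 ACCEPTED; namespace `…Theorems.CoerciveSeaNegative`, same names); duplicated here so that
the work file elaborates stand-alone. -/

/-- **Pin ⇒ `a_k / Z_m k → 0`.** For the verbatim pin clause (any `N_f`, any real `M₀`, no scaling
hypothesis): comparing the pin windows (`PinClause.mass_mem_Ioo`) at the depths `M₀ + 1` and
`M₀ + 1 + 8/b` gives `(a_k/Z_m k)·(8/b) < 8`, i.e. `a_k/Z_m k < b`, eventually, for every `b > 0`.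
So the pin by itself pins the lattice-to-bare mass conversion: it is NOT `HasMassScaling` that
kills the heavy corner. [folklore] -/
theorem PinClause.tendsto_a_div_Zm {Nf : ℕ} {reg : QCDRegularisation Nf} {M₀ : ℝ} {m : Fin Nf → ℝ}
    {R : ℝ} (h : PinClause Nf reg M₀ m R) :
    Tendsto (fun k => reg.a k / reg.Zm k) atTop (nhds 0) := by
  rw [tendsto_order]
  refine ⟨fun b hb => Eventually.of_forall fun k => hb.trans_le ?_, fun b hb => ?_⟩
  · exact div_nonneg (reg.a_pos k).le (reg.Zm_pos k).le
  · have h1 := h.mass_mem_Ioo (M := M₀ + 1) (by linarith)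
    have h8b : (0 : ℝ) < 8 / b := by positivity
    have h2 := h.mass_mem_Ioo (M := M₀ + 1 + 8 / b) (by linarith)
    filter_upwards [h1, h2] with k hk1 hk2
    have ha := reg.a_pos k
    have hZ := reg.Zm_pos k
    have hlt : reg.a k * (M₀ + 1 + 8 / b) / reg.Zm k - 8 < reg.a k * (M₀ + 1) / reg.Zm k := by
      linarith [hk1.2, hk2.1]
    have hkey : reg.a k / reg.Zm k * (8 / b) < 8 := by
      have : reg.a k * (M₀ + 1 + 8 / b) / reg.Zm k - reg.a k * (M₀ + 1) / reg.Zm k =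
          reg.a k / reg.Zm k * (8 / b) := by
        field_simp
        ring
      linarith
    calc reg.a k / reg.Zm k = reg.a k / reg.Zm k * (8 / b) / (8 / b) := by field_simp
      _ < 8 / (8 / b) := by gcongr
      _ = b := by field_simp

/-- **Pin ⇒ every valence offset vanishes in lattice units**: `a_k μ / Z_m k → 0` for every `μ` —
every valence mass `mcrit k + a_k m_f/Z_m k` and every pin probe `mcrit k − a_k M/Z_m k` merges with
`mcrit k`. [folklore] -/
theorem PinClause.tendsto_valenceOffset {Nf : ℕ} {reg : QCDRegularisation Nf} {M₀ : ℝ}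
    {m : Fin Nf → ℝ} {R : ℝ} (h : PinClause Nf reg M₀ m R) (μ : ℝ) :
    Tendsto (fun k => reg.a k * μ / reg.Zm k) atTop (nhds 0) := by
  have := h.tendsto_a_div_Zm.mul_const μ
  rw [zero_mul] at this
  refine this.congr fun k => ?_
  ring

/-- **Pin ⇒ `limsup mcrit ≤ 0`** (no scaling hypothesis, every `N_f`): `mcrit k < η` eventually for
every `η > 0`. [folklore] -/
theorem PinClause.mcrit_lt_eventually {Nf : ℕ} {reg : QCDRegularisation Nf} {M₀ : ℝ}
    {m : Fin Nf → ℝ} {R : ℝ} (h : PinClause Nf reg M₀ m R) {η : ℝ} (hη : 0 < η) :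
    ∀ᶠ k in atTop, reg.mcrit k < η := by
  have h1 := h.mass_mem_Ioo (M := M₀ + 1) (by linarith)
  have h2 := (tendsto_order.mp (h.tendsto_valenceOffset |M₀ + 1|)).2 η hη
  filter_upwards [h1, h2] with k hk1 hk2
  have ha := reg.a_pos k
  have hZ := reg.Zm_pos k
  have hle : reg.a k * (M₀ + 1) / reg.Zm k ≤ reg.a k * |M₀ + 1| / reg.Zm k := by
    gcongr
    exact le_abs_self _
  linarith [hk1.2]

/-- **Pin ⇒ `liminf mcrit ≥ −8`** (for `M₀ > −1`; the crux has `M₀ ≥ 0`). [folklore] -/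
theorem PinClause.neg_eight_lt_mcrit_eventually {Nf : ℕ} {reg : QCDRegularisation Nf} {M₀ : ℝ}
    {m : Fin Nf → ℝ} {R : ℝ} (h : PinClause Nf reg M₀ m R) (hM₀ : -1 < M₀) :
    ∀ᶠ k in atTop, -8 < reg.mcrit k := by
  filter_upwards [h.mass_mem_Ioo (M := M₀ + 1) (by linarith)] with k hk
  have hpos : 0 < reg.a k * (M₀ + 1) / reg.Zm k :=
    div_pos (mul_pos (reg.a_pos k) (by linarith)) (reg.Zm_pos k)
  linarith [hk.1]

/-- Any witness of the crux body has `a_k/Z_m k → 0`, `limsup mcrit ≤ 0`, `liminf mcrit ≥ −8` —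
from the pin alone. [folklore] -/
theorem CoerciveSeaAt.pin_asymptotics {Nf : ℕ} {reg : QCDRegularisation Nf}
    (h : CoerciveSeaAt Nf reg) :
    Tendsto (fun k => reg.a k / reg.Zm k) atTop (nhds 0) ∧
      (∀ η : ℝ, 0 < η → ∀ᶠ k in atTop, reg.mcrit k < η) ∧ (∀ᶠ k in atTop, -8 < reg.mcrit k) := by
  obtain ⟨M₀, hM₀, hm⟩ := h.pin
  haveI : Nonempty (Fin Nf → ℝ) := ⟨fun _ => M₀ + 1⟩
  obtain ⟨R, -, hpin⟩ := hm (fun _ => M₀ + 1) (fun _ => by linarith)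
  exact ⟨hpin.tendsto_a_div_Zm, fun η hη => hpin.mcrit_lt_eventually hη,
    hpin.neg_eight_lt_mcrit_eventually (by linarith)⟩

/-- **The heavy junk corner is dead for EVERY `N_f`** (supersedes Part A.3's
`not_coerciveSeaAt_of_frequently_ge`, which needed `N_f ≤ 16` and used `HasMassScaling`).
[folklore] -/
theorem not_coerciveSeaAt_of_frequently_pos {Nf : ℕ} {reg : QCDRegularisation Nf} {c : ℝ}
    (hc : 0 < c) (hge : ∃ᶠ k : ℕ in atTop, c ≤ reg.mcrit k) : ¬ CoerciveSeaAt Nf reg := by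
  intro h
  obtain ⟨-, hlt, -⟩ := h.pin_asymptotics
  exact (hge.and_eventually (hlt c hc)).exists.elim fun k hk => absurd hk.2 (not_lt.mpr hk.1)

/-- `heavyJunkReg` is no witness, for every `N_f` (Part C's dichotomy without `N_f ≤ 16`).
[folklore] -/
theorem heavyJunk_dichotomy_all (Nf : ℕ) :
    CoerciveSeaWithoutPinAt Nf (heavyJunkReg Nf) ∧ ¬ CoerciveSeaAt Nf (heavyJunkReg Nf) :=
  ⟨coerciveSeaWithoutPinAt_heavyJunkReg Nf, not_coerciveSeaAt_of_frequently_pos one_pos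
    (Eventually.frequently (Eventually.of_forall fun _ => le_rfl))⟩

/-- On the crux itself: every witness regularisation has the three pin asymptotics. [folklore] -/
theorem coerciveSea_pin_asymptotics (h : Summit.QuantumFields.QCD.Theses.NestedDissectionSea.CoerciveSea)
    (Nf : ℕ) (hNf : Nf = 2 ∨ Nf = 3) :
    ∃ reg : QCDRegularisation Nf, CoerciveSeaAt Nf reg ∧
      Tendsto (fun k => reg.a k / reg.Zm k) atTop (nhds 0) ∧
      (∀ η : ℝ, 0 < η → ∀ᶠ k in atTop, reg.mcrit k < η) ∧ (∀ᶠ k in atTop, -8 < reg.mcrit k) := by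
  obtain ⟨reg, hreg⟩ := coerciveSea_iff.mp h Nf hNf
  exact ⟨reg, hreg, hreg.pin_asymptotics⟩

/-! ## Part F (cycle 2) — RESOLUTION OF CLAUSE (i): the valence offset is invisible at the window top

Clause (i) measures separator singularity of a window box of side `s` (`s a_k ≤ ℓ`) in the
Dirichlet-gap unit `1/s₀`. The valence offset `a_k m_f/Z_m k` in that unit is `≤ m_f ℓ/Z_m k → 0`
(`HasMassScaling`: `Z_m → ∞`). So eventually in `k`, on EVERY window box, the valence mass, the
critical line and every pin probe are closer to each other than any fixed fraction `η/s` of the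
threshold: at the resolution of (i) they coincide — (i) is a statement AT the critical line, and a
proof cannot use the bare valence offset as a spectral cushion at the window top (it can below the
scale `s ≍ Z_m k/(m_f a_k)`… which is outside the window). -/

/-- For a window box side (`s · a_k ≤ ℓ`) and `μ ≥ 0`: valence offset × side `≤ μ ℓ / Z_m k`.
[folklore] -/
theorem valenceOffset_mul_side_le {Nf : ℕ} (reg : QCDRegularisation Nf) {μ ℓ : ℝ} (hμ : 0 ≤ μ)
    (k : ℕ) {s : ℕ} (hs : (s : ℝ) * reg.a k ≤ ℓ) :
    reg.a k * μ / reg.Zm k * s ≤ μ * ℓ / reg.Zm k := by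
  have hZ := reg.Zm_pos k
  rw [div_mul_eq_mul_div, div_le_div_iff_of_pos_right hZ]
  calc reg.a k * μ * s = μ * ((s : ℝ) * reg.a k) := by ring
    _ ≤ μ * ℓ := by gcongr

/-- `μ ℓ / Z_m k → 0` under `HasMassScaling` (`N_f ≤ 16`; `Z_m → ∞` is
`RobustYangMillsHandover.Negative.tendsto_Zm_atTop`). [folklore] -/
theorem tendsto_valenceOffset_mul_windowTop {Nf : ℕ} (hNf : Nf ≤ 16) (reg : QCDRegularisation Nf)
    (hms : reg.HasMassScaling) (μ ℓ : ℝ) :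
    Tendsto (fun k => μ * ℓ / reg.Zm k) atTop (nhds 0) := by
  have hZ := Summit.QuantumFields.QCD.Theorems.RobustYangMillsHandover.Negative.tendsto_Zm_atTop
    hNf reg hms
  simpa [div_eq_mul_inv] using (tendsto_const_nhds (x := μ * ℓ)).mul hZ.inv_tendsto_atTop

/-- **Resolution of clause (i), assembled**: along any regularisation with `HasMassScaling`
(`N_f ≤ 16`), for every `μ ≥ 0`, window `ℓ`, `η > 0`: eventually in `k`, on every window box side
`s ≥ 1` with `s a_k ≤ ℓ`, the valence offset `a_k μ / Z_m k` is below `η / s`. [folklore] -/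
theorem valenceOffset_lt_div_side_eventually {Nf : ℕ} (hNf : Nf ≤ 16) (reg : QCDRegularisation Nf)
    (hms : reg.HasMassScaling) {μ : ℝ} (hμ : 0 ≤ μ) (ℓ : ℝ) {η : ℝ} (hη : 0 < η) :
    ∀ᶠ k in atTop, ∀ s : ℕ, 1 ≤ s → (s : ℝ) * reg.a k ≤ ℓ →
      reg.a k * μ / reg.Zm k < η / s := by
  filter_upwards [(tendsto_order.mp (tendsto_valenceOffset_mul_windowTop hNf reg hms μ ℓ)).2 η hη]
    with k hk s hs1 hs
  have hspos : (0 : ℝ) < s := by exact_mod_cast hs1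
  rw [lt_div_iff₀ hspos]
  exact (valenceOffset_mul_side_le reg hμ k hs).trans_lt hk

/-- Applied to a witness of the crux body (which carries `HasMassScaling`), `N_f ≤ 16`: on window
boxes the valence masses `mq_f` of clauses (i)–(ii) are within `η/s` of `mcrit k`, eventually, for
every `η > 0`. [folklore] -/
theorem CoerciveSeaAt.valence_within_resolution {Nf : ℕ} (hNf : Nf ≤ 16) {reg : QCDRegularisation Nf}
    (h : CoerciveSeaAt Nf reg) {μ : ℝ} (hμ : 0 ≤ μ) (ℓ : ℝ) {η : ℝ} (hη : 0 < η) :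
    ∀ᶠ k in atTop, ∀ s : ℕ, 1 ≤ s → (s : ℝ) * reg.a k ≤ ℓ →
      |(reg.mcrit k + reg.a k * μ / reg.Zm k) - reg.mcrit k| < η / s := by
  filter_upwards [valenceOffset_lt_div_side_eventually hNf reg h.1 hμ ℓ hη] with k hk s hs1 hs
  have hnn : 0 ≤ reg.a k * μ / reg.Zm k :=
    div_nonneg (mul_nonneg (reg.a_pos k).le hμ) (reg.Zm_pos k).le
  rw [add_sub_cancel_left, abs_of_nonneg hnn]
  exact hk s hs1 hs

/-! ## Part G (cycle 2) — a crossing is a `|μ − μ'|`-pseudomode of the CELL at every mass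
(deterministic); the separator analogue fails (steepness), see Part D' -/

/-- The bare mass enters every Dirichlet cell as a scalar shift:
`D_c(μ) = D_c(μ') + (μ − μ')·1` (`wilsonDirac_mass_eq_add_scalar` compressed to the box). [folklore] -/
theorem wilsonCell_mass_shift {Nt : ℕ} [NeZero Nt]
    (U : GaugeConfig 4 Nt (Matrix.specialUnitaryGroup (Fin 3) ℂ)) (μ μ' : ℝ) (x : TorusSite 4 Nt)
    (s : Fin 4 → ℕ) :
    wilsonCell U μ x s = wilsonCell U μ' x s + ((μ - μ' : ℝ) : ℂ) • (1 : Matrix _ _ ℂ) := by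
  ext p q
  simp only [wilsonCell, toSquareBlockProp_def, Matrix.of_apply, Matrix.add_apply,
    Matrix.smul_apply, Matrix.one_apply, smul_eq_mul]
  rw [wilsonDirac_mass_eq_add_scalar _ U μ 1, wilsonDirac_mass_eq_add_scalar _ U μ' 1]
  simp only [Matrix.add_apply, Matrix.scalar_apply]
  by_cases hpq : p = q
  · subst hpq
    simp only [Matrix.diagonal_apply_eq, if_true]
    push_cast
    ring
  · have hpq' : (p : TorusSite 4 Nt × Fin 3 × Fin 4) ≠ q := fun h => hpq (Subtype.ext h)
    simp only [Matrix.diagonal_apply_ne _ hpq', if_neg hpq]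
    ring

/-- **A crossing at `μ'` is an exact `|μ − μ'|`-pseudomode of the cell at every mass `μ`**: a kernel
vector `w` of `D_c(μ')` satisfies `D_c(μ) w = (μ − μ')·w`. [folklore] -/
theorem exists_pseudomode_of_det_eq_zero {Nt : ℕ} [NeZero Nt]
    {U : GaugeConfig 4 Nt (Matrix.specialUnitaryGroup (Fin 3) ℂ)} {μ' : ℝ} {x : TorusSite 4 Nt}
    {s : Fin 4 → ℕ} (h : (wilsonCell U μ' x s).det = 0) (μ : ℝ) :
    ∃ w : {p // wilsonBox x s p} → ℂ, w ≠ 0 ∧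
      wilsonCell U μ x s *ᵥ w = ((μ - μ' : ℝ) : ℂ) • w := by
  obtain ⟨w, hw, hDw⟩ := Matrix.exists_mulVec_eq_zero_iff.mpr h
  refine ⟨w, hw, ?_⟩
  rw [wilsonCell_mass_shift U μ μ' x s, Matrix.add_mulVec, hDw, zero_add, Matrix.smul_mulVec,
    Matrix.one_mulVec]

/-- … hence the CELL near-kernel event `{∃ w ≠ 0, ‖D_c(μ) w‖² < τ² ‖w‖²}` holds at every mass `μ`
with `|μ − μ'| < τ`: every crossing within `τ` of the valence mass makes the cell `τ`-near-singular
there (the lower-bound direction for a CELL Wegner law: its probability at level `τ = t/s` is at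
least that of a crossing in the mass window `(mq − t/s, mq + t/s)`). For the SEPARATOR event of
clause (i) no such implication holds: `S_Σ(μ) = D_ΣΣ(μ) − D_ΣI D_II(μ)⁻¹ D_IΣ` moves with the mass at
speed `‖1 + D_ΣI D_II⁻² D_IΣ‖`, typically `≍ s^{3/2}–s²` in a box of side `s` (Part D'). [folklore] -/
theorem cell_nearSingular_of_crossing {Nt : ℕ} [NeZero Nt]
    {U : GaugeConfig 4 Nt (Matrix.specialUnitaryGroup (Fin 3) ℂ)} {μ' : ℝ} {x : TorusSite 4 Nt}
    {s : Fin 4 → ℕ} (h : (wilsonCell U μ' x s).det = 0) {μ τ : ℝ} (hτ : |μ - μ'| < τ) :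
    ∃ w : {p // wilsonBox x s p} → ℂ, w ≠ 0 ∧
      ∑ p, ‖(wilsonCell U μ x s *ᵥ w) p‖ ^ 2 < τ ^ 2 * ∑ p, ‖w p‖ ^ 2 := by
  obtain ⟨w, hw, hDw⟩ := exists_pseudomode_of_det_eq_zero h μ
  refine ⟨w, hw, ?_⟩
  have hn : 0 < ∑ p, ‖w p‖ ^ 2 := by
    obtain ⟨p, hp⟩ : ∃ p, w p ≠ 0 := by
      by_contra hall; push Not at hall; exact hw (funext hall)
    exact Finset.sum_pos' (fun q _ => by positivity) ⟨p, Finset.mem_univ _, by positivity⟩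
  have heq : ∑ p, ‖(wilsonCell U μ x s *ᵥ w) p‖ ^ 2 = (μ - μ') ^ 2 * ∑ p, ‖w p‖ ^ 2 := by
    rw [hDw, Finset.mul_sum]
    refine Finset.sum_congr rfl fun p _ => ?_
    rw [Pi.smul_apply, smul_eq_mul, norm_mul, Complex.norm_real, Real.norm_eq_abs, mul_pow, sq_abs]
  rw [heq]
  have h2 : (μ - μ') ^ 2 < τ ^ 2 := by
    have := abs_nonneg (μ - μ')
    calc (μ - μ') ^ 2 = |μ - μ'| ^ 2 := (sq_abs _).symm
      _ < τ ^ 2 := by gcongr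
  exact mul_lt_mul_of_pos_right h2 hn

/-- **Two-sided bracketing of a negative cell**: if a Dirichlet cell is negative at `μ` then it has a
crossing in `(μ, 0]` (route item `SignDefectForcesCrossing`, the crossing ABOVE) AND one in
`[−8, μ)` (the crossing BELOW): the determinant is a real polynomial in the mass, `≥ 0` at `0` and at
`−8` by positivity off the hopping band (Part B) and continuity. The lower crossing is a real
eigenvalue `> |μ|` of the massless cell operator (a doubler-side or deeper physical real mode); sign
bookkeeping that counts only crossings above the valence mass is complete only modulo this pairing.
[folklore] -/
theorem crossing_above_and_below_of_neg {Nt : ℕ} [NeZero Nt]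
    (U : GaugeConfig 4 Nt (Matrix.specialUnitaryGroup (Fin 3) ℂ)) {μ : ℝ} (x : TorusSite 4 Nt)
    (s : Fin 4 → ℕ) (hneg : cellDetRe U μ x s < 0) :
    (∃ μ₁ ∈ Set.Ioc μ 0, (wilsonCell U μ₁ x s).det = 0) ∧
      (∃ μ₂ ∈ Set.Ico (-8 : ℝ) μ, (wilsonCell U μ₂ x s).det = 0) := by
  -- the real polynomial f(ν) = Re det D_c(ν): continuous, ≥ 0 off the open band (−8, 0)
  set f : ℝ → ℝ := fun ν => cellDetRe U ν x s with hf
  have hcont : Continuous f := by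
    have h1 : Continuous fun ν : ℝ => wilsonCell U ν x s := by
      have : (fun ν : ℝ => wilsonCell U ν x s) =
          fun ν : ℝ => wilsonCell U 0 x s + ((ν - 0 : ℝ) : ℂ) • (1 : Matrix _ _ ℂ) :=
        funext fun ν => wilsonCell_mass_shift U ν 0 x s
      rw [this]
      exact continuous_const.add ((Complex.continuous_ofReal.comp (continuous_id.sub
        continuous_const)).smul continuous_const)
    exact Complex.continuous_re.comp h1.matrix_det
  have hreal : ∀ ν, ((wilsonCell U ν x s).det : ℂ) = ((f ν : ℝ) : ℂ) := fun ν =>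
    Complex.ext (by simp [hf, cellDetRe_eq]) (by simpa using det_wilsonCell_im U ν x s)
  have hzero : ∀ ν, f ν = 0 → (wilsonCell U ν x s).det = 0 := fun ν hν => by
    rw [hreal ν, hν]; simp
  have hpos : ∀ ν : ℝ, (0 < ν ∨ ν < -8) → 0 < f ν := by
    intro ν hν
    have h4 : 4 < |ν + 4| := by
      rcases hν with h | h
      · rw [abs_of_pos (by linarith)]
        linarith
      · rw [abs_of_neg (by linarith)]
        linarith
    exact cellDetRe_pos U h4 x s
  have hnonneg : ∀ ν : ℝ, (0 ≤ ν ∨ ν ≤ -8) → 0 ≤ f ν := by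
    intro ν hν
    rcases hν with hν | hν
    · rcases hν.lt_or_eq with hlt | heq
      · exact (hpos ν (Or.inl hlt)).le
      · subst heq
        have ht : Tendsto f (nhdsWithin 0 (Set.Ioi 0)) (nhds (f 0)) :=
          (hcont.tendsto 0).mono_left nhdsWithin_le_nhds
        exact ge_of_tendsto ht
          (eventually_nhdsWithin_of_forall fun ν hν => (hpos ν (Or.inl hν)).le)
    · rcases hν.lt_or_eq with hlt | heq
      · exact (hpos ν (Or.inr hlt)).le
      · subst heq
        have ht : Tendsto f (nhdsWithin (-8) (Set.Iio (-8))) (nhds (f (-8))) :=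
          (hcont.tendsto (-8)).mono_left nhdsWithin_le_nhds
        exact ge_of_tendsto ht
          (eventually_nhdsWithin_of_forall fun ν hν => (hpos ν (Or.inr hν)).le)
  have hμ0 : μ < 0 := by
    by_contra hge; push Not at hge; exact absurd (hnonneg μ (Or.inl hge)) (not_le.mpr hneg)
  have hμ8 : -8 < μ := by
    by_contra hle; push Not at hle; exact absurd (hnonneg μ (Or.inr hle)) (not_le.mpr hneg)
  constructor
  · -- IVT on [μ, 0]
    have hmem : (0 : ℝ) ∈ Set.Icc (f μ) (f 0) := ⟨hneg.le, hnonneg 0 (Or.inl le_rfl)⟩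
    obtain ⟨ν, hν, hν0⟩ := intermediate_value_Icc hμ0.le hcont.continuousOn hmem
    refine ⟨ν, ⟨lt_of_le_of_ne hν.1 ?_, hν.2⟩, hzero ν hν0⟩
    rintro rfl; exact absurd hν0 hneg.ne
  · -- IVT on [−8, μ]
    have hmem : (0 : ℝ) ∈ Set.Icc (f μ) (f (-8)) := ⟨hneg.le, hnonneg (-8) (Or.inr le_rfl)⟩
    obtain ⟨ν, hν, hν0⟩ := intermediate_value_Icc' hμ8.le hcont.continuousOn hmem
    refine ⟨ν, ⟨hν.1, lt_of_le_of_ne hν.2 ?_⟩, hzero ν hν0⟩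
    rintro rfl; exact absurd hν0 hneg.ne


/-! ## Part D' (cycle 2) — margins, threats and near-misses found this cycle (prose) -/

/-- **Cycle-2 reading of the three clauses (what a prover can and cannot use; where a kill would
come from). Numbers, not adjectives.**

* RESOLUTION (Part F, rigorous). On a window box of side `s` (`s a_k ≤ ℓ`) the valence offset in
  the Dirichlet-gap unit is `(a_k m_f/Z_m k)·s ≤ m_f ℓ/Z_m k → 0` (`Z_m k ≍ c (log a_k⁻²)^{γ₀/2b₀}`,
  exponent `4/9` (`N_f = 3`), `12/29` (`N_f = 2`)). Numerically (CLS-like, `a m_s/Z_m ≈ 0.059` at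
  `a = 0.086 fm`, window top `ℓ = 0.5 fm ⇒ s = 5.8`): offset × side `≈ 0.34` — NOT yet small; the
  asymptotic regime of clause (i) (`m_f ℓ/Z_m k ≪ 1`) is far beyond present lattices (a factor `e` in
  `Z_m` costs `a ↦ a^{1/ (2·4/9)}`-type changes… concretely `Z_m` doubles only when `log a⁻²` grows by
  `2^{9/4} ≈ 4.8`). Provers: every uniform-in-`k` estimate for (i) must hold AT the critical line.
* PIN SELF-SUFFICIENCY (Part E, rigorous). The pin alone forces `a_k/Z_m k → 0` and
  `mcrit k → (−8, 0]`-cluster with `limsup ≤ 0`; `HasMassScaling` is not what excludes the heavy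
  corner. Consequence for statement design (for the planner, not a refutation): in `CoerciveSea` the
  hypothesis `reg.HasMassScaling` is used by NO clause except through `Z_m → ∞` (resolution above)
  and the meaning of `m_f`; `(reg.scheme 0 0 0).HasAsymptoticScaling` enters only through `β_k` in
  `wilsonMeasure`.
* SEPARATOR vs CELL (exact linear algebra, recorded by ideator 2 / triage r1 and used here): for a
  vector harmonic on the children interiors `(D_c w)_Σ = S_Σ w_Σ`, so `HasSingularSeparator U μ s τ`
  is exactly `σ_min(S_Σ(μ)) < τ` whenever the children block `D_II(μ)` is invertible, and
  `σ_min(S_Σ) = 1/‖(D_c⁻¹)_ΣΣ‖ ≥ σ_min(D_c)` (cycle 1: separator event ⊆ cell event). STEEPNESS: the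
  Schur complement moves with the mass at speed `S_Σ'(μ) = 1_Σ + D_ΣI D_II(μ)⁻² D_IΣ`, of norm up to
  `1 + 16/σ_min(D_II)² ≍ s²` for children coercive at the Dirichlet scale; so a crossing OWNED by the
  separator at `μ_×` (`det S_Σ(μ_×) = 0`, children invertible) makes `σ_min(S_Σ(μ))` small only for
  `|μ − μ_×| ≲ τ/‖S_Σ'‖`: the set of masses at which a given configuration has a `τ`-singular
  separator has length `≍ τ/s^{p}`, `p ∈ [0, 2]`, per owned crossing, against `2τ` for the cell event
  (Part G, `cell_nearSingular_of_crossing`). Reading: (i) at a FIXED mass is friendlier than a cell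
  Wegner law by up to the steepness factor; conversely the bridge (`SeaFactorisationBridge` step (1))
  must not read (i) as "separators are coercive in a mass window". Toy calibration of `p`: job
  j013303 (below).
* PIN versus (i) — a consistency count, not a contradiction. The pin gives, on the smallest
  admissible torus (physical side `R' ∈ [R, R + 2a_k]`), `P(#{real torus modes crossing in
  (mcrit − a_kM/Z_m, 0]} odd) ≥ 1/4`, hence `E # ≥ 1/4` band-or-above crossings per `R'⁴`; by
  translation invariance a window-top box hosts on average `≳ (ℓ/R')⁴/4` of them. A hosted crossing
  at `μ'` with `|mq − μ'| ≤ a_k(M + m_f)/Z_m` makes the OWNING cell `(M + m_f)ℓ/Z_m k`-near-singular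
  in gap units (Part G + resolution) — `→ 0`, i.e. inside the event of a CELL Wegner law at every
  fixed `t`, eventually. So a cell Wegner law `P ≤ C t^α` uniform in `k` forces the probability that a
  window cell OWNS a band crossing to vanish as `k → ∞`; physically it does not vanish but is small:
  lumps of physical size `ρ < ℓ` inside the cell are lifted by Dirichlet cutting by `≍ a_k ρ²/ℓ³`
  (leakage) `≫ a_k/Z_m` eventually, so they leave the band but stay `(ρ/ℓ)²`-near-singular in gap
  units; with the dilute-gas density `C_N Λ^b ρ^{b−5} dρ` this gives a FLOOR
  `P(E_t^{cell}) ≳ C_N (ℓΛ)^b t^{(b−4)/2}` (`b = 11 − 2N_f/3`): any cell Wegner law has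
  `α_cell ≤ (b − 4)/2 = 2.5 (N_f = 3), 2.83 (N_f = 2)` and a constant `≥ C_N(ℓΛ)^b`; the separator
  version inherits `α ≤ (b−4)/2 + (steepness bonus)`. Consistent with the route's own
  `P ≲ (ℓΛ)^b t^{b−4}` (which assumes the lift law `ρ/s²`); the toy j013303 measures the lift.
* THERMODYNAMIC LIMIT AT FIXED CUTOFF (the refuter's `S → ∞` lever) against PRINT: in the ε-regime
  random-matrix theory of the Wilson Dirac operator (Kieburg–Verbaarschot–Zafeiropoulos, PRL 108
  (2012) 022001 = arXiv:1109.0656, p. 4) the number of ADDITIONAL real modes (collision-born pairs)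
  is `N_add ∝ â^{2(ν+1)}` for `â ≪ 1` and `∝ â` for `â ≫ 1`, `â = a (W₈ V)^{1/2}`, the `ν` index modes
  spread around the critical point with Gaussian width `2â` in units of `1/(ΣV)` (physical mass width
  `2a (W₈/V)^{1/2}/Σ`), and for `â ≫ 1` the real modes fill a plateau of width `16 â²/(ΣV) = 16 a² W₈/Σ`
  (volume-independent: the Aoki/Sharpe–Singleton band, `∝ a²` in physical mass, `a³` in lattice
  units). Readings: (a) a window cell of physical size `ℓ` has `â_cell = a_k W₈^{1/2} ℓ² → 0`, so
  collision-born pairs inside it have probability `≍ a_k² W₈ ℓ⁴ → 0` and its index modes cross within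
  `2 a_k W₈^{1/2}/(Σ ℓ²)` (physical) of the line, far below the valence offset `m_f/Z_m k` — print
  SUPPORTS (ii) and the pin scale separation (band `∝ a²·` vs offset `∝ 1/log`); (b) at fixed `k` and
  `S → ∞` the torus has `â → ∞`: real modes populate the `16 a_k² W₈/Σ` band around `mcrit`; the pin
  probe sits `a_k M/Z_m ≫ a_k² W₈/Σ` below it (eventually), in the region where the count of real
  modes above the probe is extensive and its parity fair — consistent with `P ≥ 1/4` (no lever);
  (c) the valence mass sits above the band by the same margin, where (GSS) near-zero modes of
  `γ₅ D_W(mq)` are localised lattice artefacts of unknown but small density — the only printed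
  quantity that could still sink (i)/(ii) is that density per site per unit mass at `mq`, needed
  `≲ a_k³` (cycle 1); RMT/WχPT do not give it (it is beyond the ε-regime), numerics (MS2020) give
  `⟨n_neg⟩ ∝ a^{≈6.8}` per fixed physical volume, i.e. `≍ a_k^{10.8}` per site — margin `a_k^{7.8}`.
* THE ORDER `∀ m … ∀ᶠ k` IS LOAD-BEARING THROUGH THE SEA'S BACK-REACTION ON THE LINE (new, print
  numbers). `mcrit` is ONE sequence for all mass tuples `m`, while the jump line of the parity
  observable under the phase-quenched measure with sea masses `m` is the valence critical point of
  that measure. At two loops (Follana–Panagopoulos, PRD 63 (2001) 017501 = hep-lat/0006001, p. 5: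
  `Σ^{(2)} = (N²−1)(−0.017537 + 0.016567/N² + (N_f/N)·0.00118618)`) the fermion-loop part of the
  critical mass is `+0.00316 N_f g₀⁴` in lattice units for massless sea quarks and decouples for
  `a m_sea → ∞`: at FIXED `k`, sending `m → ∞` moves the jump line DOWN by `≈ 0.0032 N_f g₀⁴`
  (towards the quenched line), i.e. by `≫ a_k M/Z_m k` eventually (`g₀⁴ ≍ (log a_k⁻¹)⁻²` against
  `a_k`). Hence the strengthening of (iii) that is uniform in `m` (`∀ᶠ k` before `∀ m`, or `k₀`, `R`
  independent of `m`) is false on physics grounds: for `m` large at fixed `k` the probes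
  `mcrit − a_kM/Z_m`, `M ∈ (M₀, 0.003 N_f g₀⁴ Z_m/a_k)`, sit ABOVE the (nearly quenched) jump line and
  `P(Re det < 0)` is small. For each FIXED `m` the shift is `O(g₀⁴ (a_k m/Z_m) log)` = `o(a_k/Z_m)`
  (the sea mass enters the two-loop tadpole analytically, IR-safe), inside the tolerance
  `a_k M₀/Z_m` — so the crux as stated (with `k₀ = k₀(m)`) survives; a Lean refutation of the
  `m`-uniform variant would need the quenched spectral statement and is not attempted. Provers:
  any proof of (iii) must let `k₀` grow with `max_f m_f` (heavy flavours decouple at fixed cutoff).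
  (Contrast: the `M`-uniform swap `∀ᶠ k, ∀ M > M₀` is JUNK-false — the probe drops below `−8` —
  landed by the sibling seat on stmt-13900 as `NegativeCellsDiluteUniformPinFalse.not_uniform_pin`;
  the `m`-uniform swap discussed here is physics-false inside the honest window.)
* WHAT A KILL WOULD NEED (unchanged, sharpened): a `k`-uniform LOWER bound on a phase-quenched
  probability of a spectral event of Dirichlet Wilson cells under the SU(3) Wilson measure at
  `β_k → ∞` — for (i): `P(σ_min(S_Σ(mcrit_k)) < t/s) ≥ f(t)` with `f(t)/t^α → ∞` for every `α > 0`
  on window-top boxes; for (ii): a non-vanishing physical density of early crossers; for (iii): an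
  index-mode crossing band `≫ a_k/Z_m`. None is available rigorously; all three contradict the
  printed numerics. The crux resists because it is physics, honestly calibrated, with every
  degenerate parameter `∃`-bound (cycle 1) and the pin self-sufficient (cycle 2).
* TOY j013303 (this cycle; 4D SU(3) r = 1 Dirichlet cells, tree γ-conventions, γ₅-hermiticity
  of the assembled cell exact, free `s = 4` reproduces j008492's `5.82 / 6.24`). FREE CALIBRATION of
  the units of clause (i), `s·σ_min(D_c)` ∣ `s·σ_min(S_Σ)` (`S_Σ` = Schur separator = harmonic-extension
  form), bare mass `μ = 0, −0.2, −0.4, −0.8`: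
    `s = 4`: 5.82 5.15 4.51 3.36 ∣ 6.24 5.57 4.92 3.77 (separator = 80 % of the box)
    `s = 5`: 5.40 4.63 3.94 2.83 ∣ 6.32 5.53 4.82 3.72
    `s = 6`: 5.14 4.29 3.57 2.57 ∣ 6.45 5.59 4.87 3.99
    `s = 7`: 4.96 4.05 3.31 2.44 ∣ 6.81 5.86 5.13 4.46
    `s = 8`: 4.84 3.87 3.12 2.36 ∣ 7.14 6.14 5.44 5.00 (separator = 46 % of the box)
  Readings: (a) the `1/s` law of the CELL holds with a slowly falling constant (`5.8 → 4.8` at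
  `μ = 0`), no free crossing down to `μ = −0.8` at any `s ≤ 8`; (b) the SEPARATOR constant RISES with
  `s` (`6.24 → 7.14` at `μ = 0`; ratio `σ_min(S_Σ)/σ_min(D_c)` from `1.07` (`s = 4`) to `1.48` (`s = 8`)
  at `μ = 0` and `2.12` at `μ = −0.8`): as the sheet fraction drops the Schur separator becomes
  relatively MORE coercive than the cell, in line with ideator 2's `O(1)`-coercivity estimate — the
  `t/s₀` normalisation of (i) is conservative for the separator near the free corner; (c) LUMP: a
  regular-gauge BPST lump of size `ρ = 2` centred in the `s = 8` box (interior `7⁴`) produces NO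
  crossing in `μ ∈ [−1.4, 0]` — `σ_min(D_c)` falls from `0.54` (`μ = 0`; free `0.61`) to a plateau
  `0.12` below `μ = −1`: the Dirichlet walls at distance `≈ 1.7ρ` squeeze the would-be real mode out
  of the physical mass range (or into an avoided crossing). So at `s/ρ = 4` the Dirichlet LIFT is not
  a perturbation `≍ ρ/s² = 0.03` but `O(1)`: the route's LumpLifting law can only set in for
  `s/ρ ≫ 4`; the follow-up toy j014512 (LU-free, `s = 10, 12, 16`, `ρ = 2–3`) measures where. For the
  crux this cuts both ways: strong lifting makes small window cells MORE coercive (good for (i)) and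
  pushes sign carriers to scales `s ≳ 5ρ` (the census of (ii) lives at the window top). Sparse LU at
  `s = 8` costs `≈ 50 s` per mass on 4 cores (RSS 3.1 GB): Dirichlet-cell numerics beyond `s = 8`
  need matvec-only methods. (The cycle-1 toy j009655, 2D U(1), never reported — bound to the retired
  seat identity; superseded.)
-/
theorem physicsMarginsCycle2 : True := trivial


end Summit.QuantumFields.QCD.Cruxes.CoerciveSea.Disproof

end
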